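import Mathlib
import Literature.Probability.LatticeModels.WeightTable
import HarnessLib

/-!
# A combinatorial Umlaufsatz, with the sign of the winding number, for closed trails of the oriented medial graph of `ℤ²`

Topic `Literature/Probability/LatticeModels`; a self-contained combinatorial companion of the
discharge programme for crit-ising.S18, node 1 (Smirnov's s-holomorphicity of the critical
FK-Ising observable, Ann. Math. 172 (2010), §4). The planar input T2 of `WeightTable.lean`,
`medialCycle_turning` (around a cycle of minimal period `Q` of the turning rule `nextCorner β`,
`∑_{m<Q} turnSign β (orb m) = ±4`), is a theorem of the tree by two routes through Hopf-type
theorems for *simple* closed curves (`MedialCycleHopf.lean`: the coded closed self-avoiding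
lattice walk; `MedialCycleTurning.lean`: the perturbed simple polygon). This file proves it a
third time (`inv_cornerOrbit`, whose first components are the statement of
`medialCycle_turning_holds`) by a purely combinatorial argument on the medial lattice itself,
whose point is the by-product the other routes do not give: **the winding number
of a cycle of the turning rule takes only the values `0, 1` (counterclockwise cycles) or only
`0, -1` (clockwise ones)** — the discrete Jordan curve theorem for the loops of the loop
representation, in the form needed for inside/outside arguments (`MedialTrail.inv_of_isTrail`),
together with the two tools it rests on, the tube lemma and the two-trails lemma
(`MedialTrail.tube_chain`, `MedialTrail.two_trails`: two loops that touch without crossing are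
nested or disjoint; cf. Grimmett, *The Random-Cluster Model* (2006), §6.1, "each loop separates
an open cluster from a dual open cluster").

## The oriented medial graph (namespace `Literature.Probability.LatticeModels.MedialTrail`)

In the medial coordinates `(x, y) ↦ (x + y - ½, y - x + ½)` the midpoints of the edges of `ℤ²`
(the medial vertices) become the points of `ℤ²`, and the corner `(v, k)` (`Site 2 × Fin 4`,
`MedialInterfaceProofs.lean`) becomes the dart from `cpos (v, k)` one unit north, west, south or
east for `k = 0, 1, 2, 3` (`cpos`, `cdir`, `cpos_nextCorner`). These darts form **the oriented
medial graph** `IsDart`: from a vertex of even parity the darts go north and south, from an odd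
one east and west; every edge carries exactly one dart (`IsDart.not_swap`), a walk turns by `±1`
quarter turns at every vertex, and the two in-darts at a vertex are opposite, so that a closed
walk never crosses itself — it can only touch itself. One step of the turning rule is one dart,
whatever the configuration `β`, with turn `turnSign β p` (`turn_cpos`); a cycle of minimal period
is a **closed trail** (`IsTrail`: cyclic vertex list, cyclically consecutive vertices joined by
darts, darts pairwise distinct), and conversely.

## Main definitions

* `turn`, `pturn`, `cturn` (turning number in quarter turns), `pdarts`, `cdarts`;
* `dartWnd`, `wnd l F` (**winding number** of the closed walk `l` around the face `F ∈ ℤ²`, the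
  unit square `[F₁, F₁+1] × [F₂, F₂+1]`, counted on the westward ray), `lf`, `rf` (the faces left
  and right of a dart), `westSeg`, `southSeg` (the dart on the segment west/south of a face);
* `INV l`: `cturn l = 4 ∧ wnd l ⊆ {0, 1}` or `cturn l = -4 ∧ wnd l ⊆ {0, -1}`;
* `refl` (reflection `(x, y) ↦ (-x, y)`, an orientation-reversing automorphism), `lo2`, `Φ`
  (potential: total height above the lowest vertex);
* `cposOff`, `cdir`, `cpos` (the transfer).

## Main results

* Jumps: `wnd_sub_west`, `wnd_sub_south` (Kirchhoff: zero flux of a closed walk out of a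
  half-row, `sum_cdarts_sub`), `wnd_lf_sub_rf`, `IsTrail.wnd_lf`; vanishing away from the walk
  (`wnd_eq_zero_of_lt/le/gt/ge`).
* `tube`, `tube_chain`: along consecutive darts avoiding a closed walk its winding number is
  constant on the adjacent faces (the wedge face is shared).
* `two_trails`: if `wnd A ≡ α` along `B` and `wnd B ≡ β` along `A` (one common dart allowed),
  then `α = 0 ∨ β = 0` and no face has `wnd A ≠ α ∧ wnd B ≠ β` (a bounded face set with at most
  one boundary segment is empty: `exists_west_exit`, `exists_south_exit`).
* `inv_append` (**splitting step**): at a vertex passed twice, `l = A ++ B` with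
  `cturn l = cturn A + cturn B - 4t` (`local_turns`), `wnd l = wnd A + wnd B`, the constants of
  the tubes read off the far faces (`far_face`), and the two-trails lemma excludes the sign
  patterns giving `±12` or `|wnd| = 2`.
* `bump_step` (**vertex-simple step**): the eastmost east dart of the top row sits on a bump
  `p₁ z z' p₂`; either the dart `q q'` below `p₁ p₂` is on the trail — impossible, the rerouted
  trails `p₁ q q' …` and `p₂ … q q'` would contradict the two-trails lemma (`bump_conflict`) — or
  reflecting the bump down (`bump_move_trail/_wnd/_cturn/_Φ/_inv`) gives a trail of the same
  length and potential smaller by `4`; west-going top rows are handled by `refl`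
  (`inv_of_inv_map_refl`).
* **`inv_of_isTrail`** (induction on the length, then on the potential; base `inv_of_length_four`:
  unit squares), `cturn_eq_four_or`, and the export to cycles of the turning rule:
  `isTrail_cornerOrbit`, `cturn_cornerOrbit`, **`inv_cornerOrbit`** (`cdarts_map_range`,
  `cturn_map_range`, `cornerOrbit_injOn`).

All statements are about finite lists of lattice points and integers and are proved; the local
geometry is linear integer arithmetic (`omega`). H. Hopf, Compositio Math. 2 (1935), Satz I, is
the source of the turning-number statement; the generic cyclic-list lemmas follow
`RandomPlanarGeometry/HexSAWWinding.lean` (the honeycomb version for simple cycles).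
-/

namespace Literature.Probability.LatticeModels.MedialTrail

/-- Points of the medial lattice `ℤ²` (vertices of the oriented medial graph, and, with the
same coordinates, its faces: the face `(x, y)` is the unit square `[x, x+1] × [y, y+1]`).
[folklore] -/
abbrev Pt := ℤ × ℤ

/-- **The oriented medial graph of `ℤ²`.** From a vertex of even parity the two darts go north and
south, from a vertex of odd parity they go east and west (every edge of `ℤ²` carries exactly one
dart). These are the corners of `ℤ²` (`Site 2 × Fin 4`) read in medial coordinates: a walk in this
graph turns by `±π/2` at every vertex. [cite: Smirnov2010, §4, Fig. 5] -/
def IsDart (p q : Pt) : Prop :=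
  ((p.1 + p.2) % 2 = 0 ∧ q.1 = p.1 ∧ (q.2 = p.2 + 1 ∨ q.2 = p.2 - 1)) ∨
  ((p.1 + p.2) % 2 = 1 ∧ q.2 = p.2 ∧ (q.1 = p.1 + 1 ∨ q.1 = p.1 - 1))

/-- Being a dart is decidable (linear arithmetic). [folklore] -/
instance (p q : Pt) : Decidable (IsDart p q) := by unfold IsDart; infer_instance

/-- The turn of the two-step path `u → v → w`: `+1` if the second step is the first rotated by
`+π/2` (left turn), `-1` if rotated by `-π/2` (right turn), `0` otherwise. [folklore] -/
def turn (u v w : Pt) : ℤ :=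
  if w.1 - v.1 = -(v.2 - u.2) ∧ w.2 - v.2 = v.1 - u.1 then 1
  else if w.1 - v.1 = v.2 - u.2 ∧ w.2 - v.2 = -(v.1 - u.1) then -1 else 0

/-- The sum of the turns at the interior vertices of a path. [folklore] -/
def pturn : List Pt → ℤ
  | u :: v :: w :: L => turn u v w + pturn (v :: w :: L)
  | _ => 0

/-- **The turning number** (in units of `π/2`) of a cyclic vertex list: the sum of the turns at
all its vertices. [cite: Hopf1935, Satz I] -/
def cturn (l : List Pt) : ℤ := pturn (l ++ l.take 2)

/-- The darts along a path (consecutive pairs). [folklore] -/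
def pdarts : List Pt → List (Pt × Pt)
  | a :: b :: L => (a, b) :: pdarts (b :: L)
  | _ => []

/-- The darts `(cᵢ, cᵢ₊₁)` (indices mod `n`) of a vertex list read cyclically. [folklore] -/
def cdarts (l : List Pt) : List (Pt × Pt) := l.zip (l.rotate 1)

/-- Contribution of a dart to the winding number of the face `F`, computed with the horizontal ray
from the centre of `F` in direction `-e₁`: a vertical dart in column `x ≤ F.1` spanning the rows
`F.2, F.2 + 1` contributes `-1` if it points north and `+1` if it points south. [folklore] -/
def dartWnd (d : Pt × Pt) (F : Pt) : ℤ :=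
  if d.2.1 = d.1.1 ∧ d.2.2 = d.1.2 + 1 ∧ d.1.1 ≤ F.1 ∧ F.2 = d.1.2 then -1
  else if d.2.1 = d.1.1 ∧ d.2.2 = d.1.2 - 1 ∧ d.1.1 ≤ F.1 ∧ F.2 = d.2.2 then 1 else 0

/-- The winding number of a list of darts around the face `F`. [folklore] -/
def dwnd (D : List (Pt × Pt)) (F : Pt) : ℤ := (D.map fun d => dartWnd d F).sum

/-- **The winding number** of the closed dart sequence of `l` around the face `F`. [folklore] -/
def wnd (l : List Pt) (F : Pt) : ℤ := dwnd (cdarts l) F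

/-- The face to the left of an (axis-parallel unit) dart. [folklore] -/
def lf (d : Pt × Pt) : Pt :=
  if d.2.2 = d.1.2 + 1 then (d.1.1 - 1, d.1.2)
  else if d.2.2 = d.1.2 - 1 then (d.1.1, d.1.2 - 1)
  else if d.2.1 = d.1.1 + 1 then (d.1.1, d.1.2) else (d.1.1 - 1, d.1.2 - 1)

/-- The face to the right of an (axis-parallel unit) dart. [folklore] -/
def rf (d : Pt × Pt) : Pt :=
  if d.2.2 = d.1.2 + 1 then (d.1.1, d.1.2)
  else if d.2.2 = d.1.2 - 1 then (d.1.1 - 1, d.1.2 - 1)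
  else if d.2.1 = d.1.1 + 1 then (d.1.1, d.1.2 - 1) else (d.1.1 - 1, d.1.2)

/-- **Closed trail of the oriented medial graph**: a nonempty cyclic vertex list whose cyclic darts
are darts of the graph and pairwise distinct (a cycle of the turning rule `nextCorner β` of
minimal period, in medial coordinates). [cite: Smirnov2010, §4] -/
def IsTrail (l : List Pt) : Prop := l ≠ [] ∧ (cdarts l).Nodup ∧ ∀ d ∈ cdarts l, IsDart d.1 d.2

/-! ### Cyclic vertex lists: darts, rotations -/

section Cyclic

variable {l : List Pt}

/-- `pdarts` of a list with at least two entries. [folklore] -/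
@[simp] theorem pdarts_cons_cons (a b : Pt) (L : List Pt) :
    pdarts (a :: b :: L) = (a, b) :: pdarts (b :: L) := rfl

/-- A one-vertex path has no darts. [folklore] -/
@[simp] theorem pdarts_singleton (a : Pt) : pdarts [a] = [] := rfl

/-- The empty path has no darts. [folklore] -/
@[simp] theorem pdarts_nil : pdarts [] = [] := rfl

/-- Appending one vertex adds one dart. [folklore] -/
theorem pdarts_append_singleton (P : List Pt) (hP : P ≠ []) (x : Pt) :
    pdarts (P ++ [x]) = pdarts P ++ [(P.getLast hP, x)] := by
  induction P with
  | nil => exact absurd rfl hP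
  | cons a L ih =>
    cases L with
    | nil => simp [pdarts]
    | cons b L' =>
      simp only [List.cons_append, pdarts_cons_cons, ne_eq, reduceCtorEq, not_false_eq_true,
        List.getLast_cons]
      rw [← List.cons_append, ih (List.cons_ne_nil _ _)]

/-- `pdarts` splits at an overlap of two. [folklore] -/
theorem pdarts_append_cons_cons (P Q : List Pt) (x y : Pt) :
    pdarts (P ++ x :: y :: Q) = pdarts (P ++ [x]) ++ pdarts (x :: y :: Q) := by
  induction P with
  | nil => simp
  | cons a L ih =>
    cases L with
    | nil => simp
    | cons b L' => simp only [List.cons_append, pdarts_cons_cons] at ih ⊢; rw [ih]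

/-- The number of path darts. [folklore] -/
theorem length_pdarts : ∀ (P : List Pt), (pdarts P).length = P.length - 1
  | [] => rfl
  | [_] => rfl
  | a :: b :: L => by simp [length_pdarts (b :: L)]

/-- Members of `pdarts` are consecutive entries. [folklore] -/
theorem mem_pdarts_iff : ∀ {P : List Pt} {d : Pt × Pt},
    d ∈ pdarts P ↔ ∃ (i : ℕ) (h : i + 1 < P.length), d = (P[i], P[i + 1])
  | [], d => by simp
  | [a], d => by simp
  | a :: b :: L, d => by
    rw [pdarts_cons_cons, List.mem_cons, mem_pdarts_iff]
    constructor
    · rintro (rfl | ⟨i, hi, rfl⟩)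
      · exact ⟨0, by simp, rfl⟩
      · exact ⟨i + 1, by simpa using hi, rfl⟩
    · rintro ⟨i, hi, rfl⟩
      cases i with
      | zero => exact Or.inl rfl
      | succ i => exact Or.inr ⟨i, by simpa using hi, rfl⟩

/-- Both ends of a path dart lie on the path. [folklore] -/
theorem mem_of_mem_pdarts {P : List Pt} {d : Pt × Pt} (h : d ∈ pdarts P) : d.1 ∈ P ∧ d.2 ∈ P := by
  obtain ⟨i, hi, rfl⟩ := mem_pdarts_iff.1 h
  exact ⟨List.getElem_mem _, List.getElem_mem _⟩

/-- The cyclic darts of a nonempty list are its path darts plus the closing dart. [folklore] -/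
theorem cdarts_cons (a : Pt) (L : List Pt) :
    cdarts (a :: L) = pdarts (a :: L) ++ [((a :: L).getLast (List.cons_ne_nil _ _), a)] := by
  rw [cdarts, show (a :: L).rotate 1 = L ++ [a] by simp]
  suffices h : ∀ (a a' : Pt) (L : List Pt),
      (a :: L).zip (L ++ [a']) = pdarts (a :: L) ++ [((a :: L).getLast (List.cons_ne_nil _ _), a')] from
    h a a L
  intro a a' L
  induction L generalizing a with
  | nil => simp
  | cons b L ih =>
    rw [List.cons_append, List.zip_cons_cons, ih b, pdarts_cons_cons, List.getLast_cons (List.cons_ne_nil _ _)]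
    rfl

/-- The empty cyclic list has no darts. [folklore] -/
@[simp] theorem cdarts_nil : cdarts [] = [] := rfl

/-- A cyclic list has as many darts as vertices. [folklore] -/
@[simp] theorem length_cdarts (l : List Pt) : (cdarts l).length = l.length := by
  simp [cdarts]

/-- Members of `cdarts` are cyclically consecutive entries. [folklore] -/
theorem mem_cdarts_iff {d : Pt × Pt} : d ∈ cdarts l ↔
    ∃ (i : ℕ) (h : i < l.length), d = (l[i], l[(i + 1) % l.length]'(Nat.mod_lt _ (by omega))) := by
  rw [cdarts, List.mem_iff_getElem]
  simp only [List.length_zip, List.length_rotate, min_self, List.getElem_zip, List.getElem_rotate]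
  constructor
  · rintro ⟨i, hi, rfl⟩; exact ⟨i, hi, rfl⟩
  · rintro ⟨i, hi, rfl⟩; exact ⟨i, hi, rfl⟩

/-- Both ends of a cyclic dart lie on the list. [folklore] -/
theorem mem_of_mem_cdarts {d : Pt × Pt} (h : d ∈ cdarts l) : d.1 ∈ l ∧ d.2 ∈ l := by
  obtain ⟨i, hi, rfl⟩ := mem_cdarts_iff.1 h
  exact ⟨List.getElem_mem _, List.getElem_mem _⟩

/-- `cdarts` of a nonempty list via its head and last element. [folklore] -/
theorem cdarts_eq (hl : l ≠ []) : cdarts l = pdarts l ++ [(l.getLast hl, l.head hl)] := by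
  match l, hl with
  | a :: L, _ => exact cdarts_cons a L

/-- Rotations rotate the darts. [folklore] -/
theorem cdarts_rotate (l : List Pt) (k : ℕ) : cdarts (l.rotate k) = (cdarts l).rotate k := by
  apply List.ext_getElem
  · simp
  intro i h1 h2
  simp only [cdarts, List.getElem_zip, List.getElem_rotate, List.length_rotate, Prod.mk.injEq,
    List.length_zip, min_self, true_and]
  congr 1
  rw [Nat.mod_add_mod, Nat.mod_add_mod]
  congr 1
  omega

/-- Rotations permute the darts. [folklore] -/
theorem cdarts_rotate_perm (l : List Pt) (k : ℕ) : (cdarts (l.rotate k)).Perm (cdarts l) := by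
  rw [cdarts_rotate]; exact List.rotate_perm _ _

/-- A vertex of a duplicate-free cyclic list has a unique successor. [folklore] -/
theorem cdarts_succ_unique (hn : l.Nodup) {u v v' : Pt} (h : (u, v) ∈ cdarts l)
    (h' : (u, v') ∈ cdarts l) : v = v' := by
  obtain ⟨i, hi, he⟩ := mem_cdarts_iff.1 h
  obtain ⟨j, hj, he'⟩ := mem_cdarts_iff.1 h'
  simp only [Prod.mk.injEq] at he he'
  obtain rfl : i = j := (List.Nodup.getElem_inj_iff hn).1 (he.1.symm.trans he'.1)
  rw [he.2, he'.2]

/-- A vertex of a duplicate-free cyclic list has a unique predecessor. [folklore] -/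
theorem cdarts_pred_unique (hn : l.Nodup) {u u' v : Pt} (h : (u, v) ∈ cdarts l)
    (h' : (u', v) ∈ cdarts l) : u = u' := by
  obtain ⟨i, hi, he⟩ := mem_cdarts_iff.1 h
  obtain ⟨j, hj, he'⟩ := mem_cdarts_iff.1 h'
  simp only [Prod.mk.injEq] at he he'
  have hij : (i + 1) % l.length = (j + 1) % l.length :=
    (List.Nodup.getElem_inj_iff hn).1 (he.2.symm.trans he'.2)
  have : i = j := by
    rcases Nat.lt_or_ge (i + 1) l.length with hi1 | hi1 <;>
    rcases Nat.lt_or_ge (j + 1) l.length with hj1 | hj1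
    · rw [Nat.mod_eq_of_lt hi1, Nat.mod_eq_of_lt hj1] at hij; omega
    · rw [Nat.mod_eq_of_lt hi1, show j + 1 = l.length by omega, Nat.mod_self] at hij; omega
    · rw [Nat.mod_eq_of_lt hj1, show i + 1 = l.length by omega, Nat.mod_self] at hij; omega
    · omega
  subst this
  rw [he.1, he'.1]

/-- Every vertex of a cyclic list is the source of a dart. [folklore] -/
theorem exists_cdarts_fst {u : Pt} (hu : u ∈ l) : ∃ v, (u, v) ∈ cdarts l := by
  obtain ⟨i, hi, rfl⟩ := List.getElem_of_mem hu
  exact ⟨_, mem_cdarts_iff.2 ⟨i, hi, rfl⟩⟩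

/-- Every vertex of a cyclic list is the target of a dart. [folklore] -/
theorem exists_cdarts_snd {v : Pt} (hv : v ∈ l) : ∃ u, (u, v) ∈ cdarts l := by
  obtain ⟨i, hi, rfl⟩ := List.getElem_of_mem hv
  rcases Nat.eq_zero_or_pos i with rfl | hi0
  · refine ⟨l[l.length - 1]'(by omega), mem_cdarts_iff.2 ⟨l.length - 1, by omega, ?_⟩⟩
    simp only [Prod.mk.injEq, true_and]
    congr 1
    rw [show l.length - 1 + 1 = l.length by omega, Nat.mod_self]
  · refine ⟨l[i - 1]'(by omega), mem_cdarts_iff.2 ⟨i - 1, by omega, ?_⟩⟩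
    simp only [Prod.mk.injEq, true_and]
    congr 1
    rw [show i - 1 + 1 = i by omega, Nat.mod_eq_of_lt hi]

/-- Rotating a cyclic list to start with a given dart. [folklore] -/
theorem exists_rotate_eq_cons_cons (h3 : 2 ≤ l.length) {u v : Pt} (h : (u, v) ∈ cdarts l) :
    ∃ (k : ℕ) (M : List Pt), k < l.length ∧ l.rotate k = u :: v :: M := by
  obtain ⟨i, hi, he⟩ := mem_cdarts_iff.1 h
  simp only [Prod.mk.injEq] at he
  refine ⟨i, (l.rotate i).drop 2, hi, ?_⟩
  have hlen : (l.rotate i).length = l.length := List.length_rotate _ _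
  have e0 : (l.rotate i)[0]'(by omega) = u := by
    rw [List.getElem_rotate, he.1]; congr 1; simp [Nat.mod_eq_of_lt hi]
  have e1 : (l.rotate i)[1]'(by omega) = v := by
    rw [List.getElem_rotate, he.2]; congr 1; rw [Nat.add_comm]
  calc l.rotate i = (l.rotate i).drop 0 := rfl
    _ = (l.rotate i)[0]'(by omega) :: (l.rotate i).drop 1 := List.drop_eq_getElem_cons _
    _ = u :: ((l.rotate i)[1]'(by omega) :: (l.rotate i).drop 2) := by
        rw [e0, List.drop_eq_getElem_cons]
    _ = u :: v :: (l.rotate i).drop 2 := by rw [e1]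

/-- The darts of `u :: v :: M`. [folklore] -/
theorem cdarts_cons_cons (u v : Pt) (M : List Pt) :
    cdarts (u :: v :: M) = (u, v) :: pdarts (v :: M) ++
      [((v :: M).getLast (List.cons_ne_nil _ _), u)] := by
  rw [cdarts_cons]; rfl

/-- Path darts of a concatenation. [folklore] -/
theorem pdarts_append (A M : List Pt) (hA : A ≠ []) (hM : M ≠ []) :
    pdarts (A ++ M) = pdarts A ++ (A.getLast hA, M.head hM) :: pdarts M := by
  obtain ⟨m0, M', rfl⟩ := List.exists_cons_of_ne_nil hM
  induction A with
  | nil => exact absurd rfl hA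
  | cons a L ih =>
    rcases eq_or_ne L [] with rfl | hL
    · simp
    · obtain ⟨b, L', rfl⟩ := List.exists_cons_of_ne_nil hL
      simp only [List.cons_append, pdarts_cons_cons, List.getLast_cons (List.cons_ne_nil _ _),
        List.head_cons] at ih ⊢
      rw [ih (List.cons_ne_nil _ _)]

/-- Cyclic darts of a concatenation: the path darts of both pieces and the two junction darts.
[folklore] -/
theorem cdarts_append (A M : List Pt) (hA : A ≠ []) (hM : M ≠ []) :
    cdarts (A ++ M) = pdarts A ++ (A.getLast hA, M.head hM) :: pdarts M ++ [(M.getLast hM, A.head hA)] := by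
  rw [cdarts_eq (by simp [hA]), pdarts_append A M hA hM, List.getLast_append_of_ne_nil _ hM,
    List.head_append_of_ne_nil]

/-- **Splitting the darts of a cycle at a repeated vertex**: if `A` and `M` start at the same vertex,
the darts of `A ++ M` are those of the cycles `A` and `M`. [folklore] -/
theorem cdarts_append_of_head_eq (A M : List Pt) (hA : A ≠ []) (hM : M ≠ [])
    (h : A.head hA = M.head hM) : cdarts (A ++ M) = cdarts A ++ cdarts M := by
  rw [cdarts_append A M hA hM, cdarts_eq hA, cdarts_eq hM, h]
  simp

/-- `pdarts` of a cons onto a nonempty list. [folklore] -/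
theorem pdarts_cons_of_ne_nil (a : Pt) {B : List Pt} (hB : B ≠ []) :
    pdarts (a :: B) = (a, B.head hB) :: pdarts B := by
  obtain ⟨b, B', rfl⟩ := List.exists_cons_of_ne_nil hB; rfl

/-- The path darts are a sublist of the cyclic darts. [folklore] -/
theorem pdarts_sublist_cdarts (l : List Pt) : (pdarts l).Sublist (cdarts l) := by
  rcases eq_or_ne l [] with rfl | hl
  · simp
  · rw [cdarts_eq hl]; exact List.sublist_append_left _ _

end Cyclic

/-! ### Turn sums of paths and cycles -/

section Turns

/-- Three-term recursion of `pturn`. [folklore] -/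
@[simp] theorem pturn_cons₃ (u v w : Pt) (L : List Pt) :
    pturn (u :: v :: w :: L) = turn u v w + pturn (v :: w :: L) := rfl

/-- Two-vertex paths have no turns. [folklore] -/
@[simp] theorem pturn_two (u v : Pt) : pturn [u, v] = 0 := rfl

/-- One-vertex paths have no turns. [folklore] -/
@[simp] theorem pturn_one (u : Pt) : pturn [u] = 0 := rfl

/-- The empty path has no turns. [folklore] -/
@[simp] theorem pturn_nil : pturn [] = 0 := rfl

/-- Peeling the first turn. [folklore] -/
theorem pturn_cons (a : Pt) (P : List Pt) (hP : 2 ≤ P.length) :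
    pturn (a :: P) = turn a (P[0]'(by omega)) (P[1]'(by omega)) + pturn P := by
  match P, hP with
  | b :: c :: L, _ => rfl

/-- Splitting a turn sum at an overlap of two vertices. [folklore] -/
theorem pturn_append_cons_cons (P Q : List Pt) (x y : Pt) :
    pturn (P ++ x :: y :: Q) = pturn (P ++ [x, y]) + pturn (x :: y :: Q) := by
  induction P with
  | nil => simp
  | cons a L ih =>
    match L, ih with
    | [], _ => simp
    | [b], _ => simp [add_assoc]
    | b :: c :: L', ih =>
      simp only [List.cons_append, pturn_cons₃] at ih ⊢
      rw [ih]; ring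

/-- **The turning number as a path turn sum**: close the cycle up with its last vertex in front and
its first vertex at the end. [folklore] -/
theorem cturn_eq_pturn (A : List Pt) (hA : 2 ≤ A.length) :
    cturn A = pturn (A.getLast (List.ne_nil_of_length_pos (by omega)) :: A ++
      [A.head (List.ne_nil_of_length_pos (by omega))]) := by
  obtain ⟨a0, a1, A', rfl⟩ : ∃ a0 a1 A', A = a0 :: a1 :: A' := by
    match A, hA with
    | a0 :: a1 :: A', _ => exact ⟨a0, a1, A', rfl⟩
  have hA0 : a0 :: a1 :: A' ≠ [] := List.cons_ne_nil _ _
  simp only [List.head_cons]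
  rw [cturn]
  simp only [List.take_succ_cons, List.take_zero]
  have e1 : a0 :: a1 :: A' ++ [a0, a1] =
      (a0 :: a1 :: A').dropLast ++ (a0 :: a1 :: A').getLast hA0 :: a0 :: [a1] := by
    conv_lhs => rw [← List.dropLast_append_getLast hA0]
    simp
  have e2 : (a0 :: a1 :: A').dropLast ++ [(a0 :: a1 :: A').getLast hA0, a0] =
      a0 :: a1 :: A' ++ [a0] := by
    conv_rhs => rw [← List.dropLast_append_getLast hA0]
    simp
  rw [e1, pturn_append_cons_cons, e2]
  simp only [List.cons_append, pturn_cons₃, pturn_two, add_zero]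
  ring

/-- Replacing the vertex in front of a closed-up path changes only the first turn. [folklore] -/
theorem pturn_cons_append_sub (x y : Pt) (A : List Pt) (hA : 2 ≤ A.length) (z : Pt) :
    pturn (x :: A ++ [z]) - pturn (y :: A ++ [z]) =
      turn x (A[0]'(by omega)) (A[1]'(by omega)) - turn y (A[0]'(by omega)) (A[1]'(by omega)) := by
  have h2 : 2 ≤ (A ++ [z]).length := by simp; omega
  show pturn (x :: (A ++ [z])) - pturn (y :: (A ++ [z])) = _
  rw [pturn_cons x (A ++ [z]) h2, pturn_cons y (A ++ [z]) h2]
  simp only [List.getElem_append_left (by omega : 0 < A.length),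
    List.getElem_append_left (by omega : 1 < A.length)]
  ring

/-- **Splitting the turning number of a cycle** written as `A ++ M` (the cycle closes from the
last vertex of `M` to the first of `A`). [folklore] -/
theorem cturn_split (A M : List Pt) (hA : 2 ≤ A.length) (hM : M ≠ []) :
    cturn (A ++ M) = pturn (M.getLast hM :: A ++ [M.head hM]) +
      pturn (A.getLast (List.ne_nil_of_length_pos (by omega)) :: M ++ [A.head
        (List.ne_nil_of_length_pos (by omega))]) := by
  obtain ⟨a0, a1, A', rfl⟩ : ∃ a0 a1 A', A = a0 :: a1 :: A' := by
    match A, hA with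
    | a0 :: a1 :: A', _ => exact ⟨a0, a1, A', rfl⟩
  obtain ⟨m0, M', rfl⟩ : ∃ m0 M', M = m0 :: M' := List.exists_cons_of_ne_nil hM
  have hA0 : a0 :: a1 :: A' ≠ [] := List.cons_ne_nil _ _
  simp only [List.head_cons]
  have h0 : cturn (a0 :: a1 :: A' ++ m0 :: M') = pturn (a0 :: a1 :: A' ++ m0 :: M' ++ [a0, a1]) := by
    rw [cturn, List.take_append_of_le_length (by simp)]; rfl
  have e1 : a0 :: a1 :: A' ++ m0 :: M' ++ [a0, a1] =
      (a0 :: a1 :: A').dropLast ++ (a0 :: a1 :: A').getLast hA0 :: m0 :: (M' ++ [a0, a1]) := by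
    conv_lhs => rw [← List.dropLast_append_getLast hA0]
    simp
  have e2 : (a0 :: a1 :: A').dropLast ++ [(a0 :: a1 :: A').getLast hA0, m0] =
      a0 :: a1 :: A' ++ [m0] := by
    conv_rhs => rw [← List.dropLast_append_getLast hA0]
    simp
  have e3 : (a0 :: a1 :: A').getLast hA0 :: m0 :: (M' ++ [a0, a1]) =
      ((a0 :: a1 :: A').getLast hA0 :: (m0 :: M').dropLast) ++ (m0 :: M').getLast hM :: a0 :: [a1] := by
    rw [show (m0 :: M').getLast hM :: a0 :: [a1] = [(m0 :: M').getLast hM] ++ [a0, a1] from rfl,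
      List.cons_append, ← List.append_assoc _ [(m0 :: M').getLast hM] _, List.dropLast_append_getLast hM]
    simp
  have e4 : (a0 :: a1 :: A').getLast hA0 :: (m0 :: M').dropLast ++ [(m0 :: M').getLast hM, a0] =
      (a0 :: a1 :: A').getLast hA0 :: (m0 :: M') ++ [a0] := by
    conv_rhs => rw [← List.dropLast_append_getLast hM]
    simp
  rw [h0, e1, pturn_append_cons_cons, e2, e3, pturn_append_cons_cons, e4]
  simp only [List.cons_append, pturn_cons₃, pturn_two, add_zero]
  ring

/-- The turning number is invariant under rotating the cycle by one (length `≥ 3`). [folklore] -/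
theorem cturn_rotate_one {l : List Pt} (h3 : 3 ≤ l.length) : cturn (l.rotate 1) = cturn l := by
  match l, h3 with
  | a :: b :: c :: M, _ =>
    rw [show (a :: b :: c :: M).rotate 1 = b :: c :: M ++ [a] by simp, cturn, cturn,
      List.take_append_of_le_length (by simp)]
    simp only [List.take_succ_cons, List.take_zero, List.cons_append, List.append_assoc,
      List.nil_append, pturn_cons₃]
    have := pturn_append_cons_cons (b :: c :: M) [c] a b
    simp only [List.cons_append, pturn_cons₃, pturn_two, add_zero] at this
    rw [this]
    ring

/-- The turning number is invariant under rotations (length `≥ 3`). [folklore] -/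
theorem cturn_rotate {l : List Pt} (h3 : 3 ≤ l.length) (k : ℕ) : cturn (l.rotate k) = cturn l := by
  induction k with
  | zero => rw [List.rotate_zero]
  | succ k ih => rw [← List.rotate_rotate, cturn_rotate_one (by rw [List.length_rotate]; exact h3), ih]

end Turns

/-! ### Winding numbers of dart lists -/

section Wnd

/-- `dwnd` of no darts. [folklore] -/
@[simp] theorem dwnd_nil (F : Pt) : dwnd [] F = 0 := rfl

/-- `dwnd` of a cons. [folklore] -/
@[simp] theorem dwnd_cons (d : Pt × Pt) (D : List (Pt × Pt)) (F : Pt) :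
    dwnd (d :: D) F = dartWnd d F + dwnd D F := by simp [dwnd]

/-- `dwnd` is additive under concatenation. [folklore] -/
@[simp] theorem dwnd_append (D D' : List (Pt × Pt)) (F : Pt) :
    dwnd (D ++ D') F = dwnd D F + dwnd D' F := by simp [dwnd]

/-- `dwnd` is invariant under permutations. [folklore] -/
theorem dwnd_perm {D D' : List (Pt × Pt)} (h : D.Perm D') (F : Pt) : dwnd D F = dwnd D' F :=
  (h.map _).sum_eq

/-- Winding numbers are invariant under rotation of the cycle. [folklore] -/
theorem wnd_rotate (l : List Pt) (k : ℕ) (F : Pt) : wnd (l.rotate k) F = wnd l F :=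
  dwnd_perm (cdarts_rotate_perm l k) F

/-- **Additivity of winding numbers under splitting at a repeated vertex.** [folklore] -/
theorem wnd_append_of_head_eq (A M : List Pt) (hA : A ≠ []) (hM : M ≠ [])
    (h : A.head hA = M.head hM) (F : Pt) : wnd (A ++ M) F = wnd A F + wnd M F := by
  rw [wnd, cdarts_append_of_head_eq A M hA hM h, dwnd_append]; rfl

end Wnd


/-! ### Jumps of the winding number across a segment -/

section Jumps

variable {l : List Pt}

/-- Per-dart jump across a vertical segment. [folklore] -/
theorem dartWnd_sub_west (d : Pt × Pt) (x y : ℤ) :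
    dartWnd d (x, y) - dartWnd d (x - 1, y) =
      (if d = ((x, y + 1), (x, y)) then 1 else 0) - (if d = ((x, y), (x, y + 1)) then 1 else 0) := by
  obtain ⟨⟨a, b⟩, ⟨c, e⟩⟩ := d
  simp only [dartWnd, Prod.mk.injEq]
  split_ifs <;> omega

/-- **Jump across a vertical segment**: the faces `(x, y)` and `(x - 1, y)` are separated by the
segment from `(x, y)` to `(x, y + 1)`; the winding number jumps by the signed number of darts on
it. [folklore] -/
theorem dwnd_sub_west (D : List (Pt × Pt)) (x y : ℤ) :
    dwnd D (x, y) - dwnd D (x - 1, y) = D.count ((x, y + 1), (x, y)) - D.count ((x, y), (x, y + 1)) := by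
  induction D with
  | nil => simp
  | cons d D ih =>
    simp only [dwnd_cons, List.count_cons, beq_iff_eq]
    have := dartWnd_sub_west d x y
    push_cast
    omega

/-- Jump of `wnd` across a vertical segment. [folklore] -/
theorem wnd_sub_west (l : List Pt) (x y : ℤ) :
    wnd l (x, y) - wnd l (x - 1, y) =
      (cdarts l).count ((x, y + 1), (x, y)) - (cdarts l).count ((x, y), (x, y + 1)) :=
  dwnd_sub_west _ x y

/-- The indicator of the vertex set `{(x', y) : x' ≤ x}` (row `y`, weakly west of `x`). [folklore] -/
def rowInd (x y : ℤ) (P : Pt) : ℤ := if P.2 = y ∧ P.1 ≤ x then 1 else 0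

/-- Per-dart flux identity across a horizontal segment: the flux of a dart out of the vertex set
`{(x', y) : x' ≤ x}` is its winding-number jump between the faces `(x, y)` and `(x, y - 1)`,
corrected by the darts on the segment from `(x, y)` to `(x + 1, y)`. [folklore] -/
theorem dart_flux (d : Pt × Pt) (hd : IsDart d.1 d.2) (x y : ℤ) :
    rowInd x y d.2 - rowInd x y d.1 = (dartWnd d (x, y) - dartWnd d (x, y - 1)) -
      (if d = ((x, y), (x + 1, y)) then 1 else 0) + (if d = ((x + 1, y), (x, y)) then 1 else 0) := by
  obtain ⟨⟨a, b⟩, ⟨c, e⟩⟩ := d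
  simp only [IsDart] at hd
  simp only [dartWnd, rowInd, Prod.mk.injEq]
  rcases hd with ⟨-, hc, he | he⟩ | ⟨-, he, hc | hc⟩ <;> subst hc <;> subst he <;>
    · split_ifs <;> omega

/-- The total flux of a closed dart sequence out of any vertex set vanishes (telescoping).
[folklore] -/
theorem sum_cdarts_sub (l : List Pt) (g : Pt → ℤ) :
    ((cdarts l).map fun d => g d.2 - g d.1).sum = 0 := by
  have h1 : ((cdarts l).map fun d => g d.2) = (l.rotate 1).map g := by
    rw [show (fun d : Pt × Pt => g d.2) = g ∘ Prod.snd from rfl, ← List.map_map, cdarts,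
      List.map_snd_zip (l₁ := l) (l₂ := l.rotate 1) (by simp)]
  have h2 : ((cdarts l).map fun d => g d.1) = l.map g := by
    rw [show (fun d : Pt × Pt => g d.1) = g ∘ Prod.fst from rfl, ← List.map_map, cdarts,
      List.map_fst_zip (l₁ := l) (l₂ := l.rotate 1) (by simp)]
  have h3 : ∀ D : List (Pt × Pt), (D.map fun d => g d.2 - g d.1).sum =
      (D.map fun d => g d.2).sum - (D.map fun d => g d.1).sum := by
    intro D
    induction D with
    | nil => simp
    | cons d D ih => simp only [List.map_cons, List.sum_cons, ih]; ring
  rw [h3, h1, h2, List.map_rotate, (List.rotate_perm _ _).sum_eq, sub_self]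

/-- Flux form of the horizontal jump, for a list of darts. [folklore] -/
theorem dwnd_sub_south_add (D : List (Pt × Pt)) (hD : ∀ d ∈ D, IsDart d.1 d.2) (x y : ℤ) :
    dwnd D (x, y) - dwnd D (x, y - 1) = D.count ((x, y), (x + 1, y)) - D.count ((x + 1, y), (x, y)) +
      (D.map fun d => rowInd x y d.2 - rowInd x y d.1).sum := by
  induction D with
  | nil => simp
  | cons d D ih =>
    simp only [dwnd_cons, List.count_cons, beq_iff_eq, List.map_cons, List.sum_cons]
    have h1 := dart_flux d (hD d (by simp)) x y
    have h2 := ih (fun e he => hD e (by simp [he]))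
    push_cast
    omega

/-- **Jump across a horizontal segment** (Kirchhoff): the faces `(x, y)` and `(x, y - 1)` are
separated by the segment from `(x, y)` to `(x + 1, y)`; the winding number of a closed dart
sequence jumps by the signed number of darts on it. [folklore] -/
theorem wnd_sub_south (hl : ∀ d ∈ cdarts l, IsDart d.1 d.2) (x y : ℤ) :
    wnd l (x, y) - wnd l (x, y - 1) =
      (cdarts l).count ((x, y), (x + 1, y)) - (cdarts l).count ((x + 1, y), (x, y)) := by
  have := dwnd_sub_south_add (cdarts l) hl x y
  rw [sum_cdarts_sub l (rowInd x y), add_zero] at this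
  exact this

/-! ### Vanishing away from the cycle -/

/-- A dart strictly east of the face contributes nothing. [folklore] -/
theorem dartWnd_eq_zero_of_lt (d : Pt × Pt) (F : Pt) (h : F.1 < d.1.1) : dartWnd d F = 0 := by
  simp only [dartWnd]; split_ifs <;> omega

/-- A dart with no endpoint in the row above the face contributes nothing. [folklore] -/
theorem dartWnd_eq_zero_of_le (d : Pt × Pt) (F : Pt) (h1 : d.1.2 ≤ F.2) (h2 : d.2.2 ≤ F.2) :
    dartWnd d F = 0 := by
  simp only [dartWnd]; split_ifs <;> omega

/-- A dart with no endpoint in the row of the face contributes nothing. [folklore] -/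
theorem dartWnd_eq_zero_of_gt (d : Pt × Pt) (F : Pt) (h1 : F.2 < d.1.2) (h2 : F.2 < d.2.2) :
    dartWnd d F = 0 := by
  simp only [dartWnd]; split_ifs <;> omega

/-- West of the cycle the winding number vanishes. [folklore] -/
theorem wnd_eq_zero_of_lt {x y : ℤ} (h : ∀ P ∈ l, x < P.1) : wnd l (x, y) = 0 := by
  rw [wnd, dwnd, List.sum_eq_zero]
  intro a ha
  rw [List.mem_map] at ha
  obtain ⟨d, hd, rfl⟩ := ha
  exact dartWnd_eq_zero_of_lt d _ (h _ (mem_of_mem_cdarts hd).1)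

/-- Above the cycle the winding number vanishes. [folklore] -/
theorem wnd_eq_zero_of_le {x y : ℤ} (h : ∀ P ∈ l, P.2 ≤ y) : wnd l (x, y) = 0 := by
  rw [wnd, dwnd, List.sum_eq_zero]
  intro a ha
  rw [List.mem_map] at ha
  obtain ⟨d, hd, rfl⟩ := ha
  exact dartWnd_eq_zero_of_le d _ (h _ (mem_of_mem_cdarts hd).1) (h _ (mem_of_mem_cdarts hd).2)

/-- Below the cycle the winding number vanishes. [folklore] -/
theorem wnd_eq_zero_of_gt {x y : ℤ} (h : ∀ P ∈ l, y < P.2) : wnd l (x, y) = 0 := by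
  rw [wnd, dwnd, List.sum_eq_zero]
  intro a ha
  rw [List.mem_map] at ha
  obtain ⟨d, hd, rfl⟩ := ha
  exact dartWnd_eq_zero_of_gt d _ (h _ (mem_of_mem_cdarts hd).1) (h _ (mem_of_mem_cdarts hd).2)

/-- Lower bounds for the coordinates of the vertices of a list. [folklore] -/
theorem exists_lower_bounds (l : List Pt) : ∃ m : ℤ, ∀ P ∈ l, m ≤ P.1 ∧ m ≤ P.2 := by
  induction l with
  | nil => exact ⟨0, by simp⟩
  | cons a L ih =>
    obtain ⟨m, hm⟩ := ih
    refine ⟨min m (min a.1 a.2), ?_⟩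
    intro P hP
    rcases List.mem_cons.1 hP with rfl | hP
    · exact ⟨(min_le_right _ _).trans (min_le_left _ _), (min_le_right _ _).trans (min_le_right _ _)⟩
    · exact ⟨(min_le_left _ _).trans (hm P hP).1, (min_le_left _ _).trans (hm P hP).2⟩

/-- Upper bounds for the coordinates of the vertices of a list. [folklore] -/
theorem exists_upper_bounds (l : List Pt) : ∃ m : ℤ, ∀ P ∈ l, P.1 ≤ m ∧ P.2 ≤ m := by
  induction l with
  | nil => exact ⟨0, by simp⟩
  | cons a L ih =>
    obtain ⟨m, hm⟩ := ih
    refine ⟨max m (max a.1 a.2), ?_⟩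
    intro P hP
    rcases List.mem_cons.1 hP with rfl | hP
    · exact ⟨(le_max_left _ _).trans (le_max_right _ _), (le_max_right _ _).trans (le_max_right _ _)⟩
    · exact ⟨(hm P hP).1.trans (le_max_left _ _), (hm P hP).2.trans (le_max_left _ _)⟩

/-- **The support of the winding number is bounded below**: a face with nonzero winding number is
weakly east and weakly north of some vertex of the cycle. [folklore] -/
theorem exists_bound_of_wnd (l : List Pt) : ∃ m : ℤ, ∀ F, wnd l F ≠ 0 → m ≤ F.1 ∧ m ≤ F.2 := by
  obtain ⟨m, hm⟩ := exists_lower_bounds l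
  refine ⟨m - 1, fun F hF => ⟨?_, ?_⟩⟩
  · by_contra h
    exact hF (wnd_eq_zero_of_lt fun P hP => by have := (hm P hP).1; omega)
  · by_contra h
    exact hF (wnd_eq_zero_of_gt fun P hP => by have := (hm P hP).2; omega)

/-- East of the cycle the winding number vanishes (zero total flux through a row). [folklore] -/
theorem wnd_eq_zero_of_ge (hl : ∀ d ∈ cdarts l, IsDart d.1 d.2) {x y : ℤ} (h : ∀ P ∈ l, P.1 ≤ x) :
    wnd l (x, y) = 0 := by
  have step : ∀ y', wnd l (x, y') = wnd l (x, y' - 1) := by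
    intro y'
    have := wnd_sub_south hl x y'
    rw [List.count_eq_zero_of_not_mem, List.count_eq_zero_of_not_mem] at this
    · simpa [sub_eq_zero] using this
    · intro hm; have := h _ (mem_of_mem_cdarts hm).1; simp at this
    · intro hm; have := h _ (mem_of_mem_cdarts hm).2; simp at this
  obtain ⟨m, hm⟩ := exists_lower_bounds l
  have desc : ∀ n : ℕ, wnd l (x, y) = wnd l (x, y - n) := by
    intro n
    induction n with
    | zero => simp
    | succ n ih => rw [ih, step]; congr 2; push_cast; ring
  rw [desc (y - m + 1).toNat]
  exact wnd_eq_zero_of_gt fun P hP => by have := (hm P hP).2; omega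

end Jumps

/-! ### Darts of the oriented medial graph; jumps across darts of a trail -/

section Typed

variable {l : List Pt}

/-- A dart joins distinct vertices. [folklore] -/
theorem IsDart.ne {p q : Pt} (h : IsDart p q) : p ≠ q := by
  rintro rfl; simp only [IsDart, true_and] at h; omega

/-- Every edge carries one dart only: the reverse of a dart is not a dart. [folklore] -/
theorem IsDart.not_swap {p q : Pt} (h : IsDart p q) : ¬ IsDart q p := by
  intro h'; simp only [IsDart] at h h'; omega

/-- A dart changes the parity of the vertex. [folklore] -/
theorem IsDart.parity {p q : Pt} (h : IsDart p q) : (q.1 + q.2) % 2 ≠ (p.1 + p.2) % 2 := by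
  simp only [IsDart] at h; omega

/-- A closed trail has at least four vertices. [folklore] -/
theorem IsTrail.four_le_length (hl : IsTrail l) : 4 ≤ l.length := by
  obtain ⟨hne, -, hd⟩ := hl
  rcases l with _ | ⟨a, _ | ⟨b, _ | ⟨c, _ | ⟨d, L⟩⟩⟩⟩
  · exact absurd rfl hne
  · have := hd (a, a) (by simp [cdarts])
    exact absurd rfl (IsDart.ne this)
  · have h1 := hd (a, b) (by simp [cdarts])
    have h2 := hd (b, a) (by simp [cdarts])
    exact absurd h2 h1.not_swap
  · have h1 := (hd (a, b) (by simp [cdarts])).parity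
    have h2 := (hd (b, c) (by simp [cdarts])).parity
    have h3 := (hd (c, a) (by simp [cdarts])).parity
    simp only at h1 h2 h3
    omega
  · simp

/-- Rotations of a trail are trails. [folklore] -/
theorem IsTrail.rotate (hl : IsTrail l) (k : ℕ) : IsTrail (l.rotate k) := by
  refine ⟨by simpa using hl.1, ?_, fun d hd => hl.2.2 d ((cdarts_rotate_perm l k).mem_iff.1 hd)⟩
  rw [cdarts_rotate]
  exact List.nodup_rotate.2 hl.2.1

/-- Left face of a north dart. [folklore] -/
@[simp] theorem lf_north (a b : ℤ) : lf ((a, b), (a, b + 1)) = (a - 1, b) := by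
  simp [lf]

/-- Right face of a north dart. [folklore] -/
@[simp] theorem rf_north (a b : ℤ) : rf ((a, b), (a, b + 1)) = (a, b) := by
  simp [rf]

/-- Left face of a south dart. [folklore] -/
@[simp] theorem lf_south (a b : ℤ) : lf ((a, b), (a, b - 1)) = (a, b - 1) := by
  simp only [lf]; split_ifs <;> first | rfl | omega

/-- Right face of a south dart. [folklore] -/
@[simp] theorem rf_south (a b : ℤ) : rf ((a, b), (a, b - 1)) = (a - 1, b - 1) := by
  simp only [rf]; split_ifs <;> first | rfl | omega

/-- Left face of an east dart. [folklore] -/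
@[simp] theorem lf_east (a b : ℤ) : lf ((a, b), (a + 1, b)) = (a, b) := by
  simp only [lf]; split_ifs <;> first | rfl | omega

/-- Right face of an east dart. [folklore] -/
@[simp] theorem rf_east (a b : ℤ) : rf ((a, b), (a + 1, b)) = (a, b - 1) := by
  simp only [rf]; split_ifs <;> first | rfl | omega

/-- Left face of a west dart. [folklore] -/
@[simp] theorem lf_west (a b : ℤ) : lf ((a, b), (a - 1, b)) = (a - 1, b - 1) := by
  simp only [lf]; split_ifs <;> first | rfl | omega

/-- Right face of a west dart. [folklore] -/
@[simp] theorem rf_west (a b : ℤ) : rf ((a, b), (a - 1, b)) = (a - 1, b) := by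
  simp only [rf]; split_ifs <;> first | rfl | omega

/-- The four kinds of darts, in coordinates. [folklore] -/
theorem IsDart.cases {d : Pt × Pt} (hd : IsDart d.1 d.2) :
    ∃ a b : ℤ, d = ((a, b), (a, b + 1)) ∨ d = ((a, b), (a, b - 1)) ∨ d = ((a, b), (a + 1, b)) ∨
      d = ((a, b), (a - 1, b)) := by
  obtain ⟨⟨a, b⟩, ⟨c, e⟩⟩ := d
  simp only [IsDart] at hd
  refine ⟨a, b, ?_⟩
  simp only [Prod.mk.injEq, true_and]
  omega

/-- **Jump across a dart**: from the face on its left to the face on its right the winding number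
of a closed walk in the oriented medial graph drops by the multiplicity of the dart. [folklore] -/
theorem wnd_lf_sub_rf (hl : ∀ e ∈ cdarts l, IsDart e.1 e.2) {d : Pt × Pt} (hd : IsDart d.1 d.2) :
    wnd l (lf d) - wnd l (rf d) = (cdarts l).count d := by
  have hsw : ∀ e : Pt × Pt, IsDart e.2 e.1 → (cdarts l).count e = 0 := fun e he =>
    List.count_eq_zero_of_not_mem fun hm => (hl e hm).not_swap he
  obtain ⟨a, b, rfl | rfl | rfl | rfl⟩ := hd.cases
  · -- north
    have h1 := wnd_sub_west l a b
    have h0 := hsw ((a, b + 1), (a, b)) (by simp only [IsDart, and_true, true_or] at hd ⊢; omega)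
    rw [lf_north, rf_north]
    rw [h0] at h1; push_cast at h1; linarith
  · -- south
    have h1 := wnd_sub_west l a (b - 1)
    have h0 := hsw ((a, b - 1), (a, b - 1 + 1)) (by simp only [IsDart, true_and, and_true, or_true] at hd ⊢; omega)
    simp only [sub_add_cancel] at h1 h0
    rw [lf_south, rf_south]
    rw [h0] at h1; push_cast at h1; linarith
  · -- east
    have h1 := wnd_sub_south hl a b
    have h0 := hsw ((a + 1, b), (a, b)) (by simp only [IsDart, and_true, true_or] at hd ⊢; omega)
    rw [lf_east, rf_east]
    rw [h0] at h1; push_cast at h1; linarith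
  · -- west
    have h1 := wnd_sub_south hl (a - 1) b
    have h0 := hsw ((a - 1, b), (a - 1 + 1, b)) (by simp only [IsDart, true_and, and_true, or_true] at hd ⊢; omega)
    simp only [sub_add_cancel] at h1 h0
    rw [lf_west, rf_west]
    rw [h0] at h1; push_cast at h1; linarith

/-- Across a dart of a trail the winding number drops by one from left to right. [folklore] -/
theorem IsTrail.wnd_lf (hl : IsTrail l) {d : Pt × Pt} (hd : d ∈ cdarts l) :
    wnd l (lf d) = wnd l (rf d) + 1 := by
  have := wnd_lf_sub_rf hl.2.2 (hl.2.2 d hd)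
  rw [List.count_eq_one_of_mem hl.2.1 hd] at this
  omega

/-- Across a dart of the graph not on the walk the winding number does not jump. [folklore] -/
theorem wnd_lf_eq_rf (hl : ∀ e ∈ cdarts l, IsDart e.1 e.2) {d : Pt × Pt} (hd : IsDart d.1 d.2)
    (hn : d ∉ cdarts l) : wnd l (lf d) = wnd l (rf d) := by
  have := wnd_lf_sub_rf hl hd
  rw [List.count_eq_zero_of_not_mem hn] at this
  omega

/-- The dart of the graph on the segment west of the face `F` (between `F` and `(F.1 - 1, F.2)`).
[folklore] -/
def westSeg (F : Pt) : Pt × Pt :=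
  if (F.1 + F.2) % 2 = 0 then ((F.1, F.2), (F.1, F.2 + 1)) else ((F.1, F.2 + 1), (F.1, F.2))

/-- The dart of the graph on the segment south of the face `F` (between `F` and `(F.1, F.2 - 1)`).
[folklore] -/
def southSeg (F : Pt) : Pt × Pt :=
  if (F.1 + F.2) % 2 = 0 then ((F.1 + 1, F.2), (F.1, F.2)) else ((F.1, F.2), (F.1 + 1, F.2))

/-- `westSeg F` is a dart of the graph. [folklore] -/
theorem isDart_westSeg (F : Pt) : IsDart (westSeg F).1 (westSeg F).2 := by
  unfold westSeg
  split_ifs with h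
  · exact Or.inl ⟨h, rfl, Or.inl rfl⟩
  · refine Or.inl ⟨?_, rfl, Or.inr ?_⟩
    · show (F.1 + (F.2 + 1)) % 2 = 0; omega
    · show F.2 = F.2 + 1 - 1; omega

/-- `southSeg F` is a dart of the graph. [folklore] -/
theorem isDart_southSeg (F : Pt) : IsDart (southSeg F).1 (southSeg F).2 := by
  unfold southSeg
  split_ifs with h
  · refine Or.inr ⟨?_, rfl, Or.inr ?_⟩
    · show (F.1 + 1 + F.2) % 2 = 1; omega
    · show F.1 = F.1 + 1 - 1; omega
  · refine Or.inr ⟨?_, rfl, Or.inl rfl⟩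
    show (F.1 + F.2) % 2 = 1; omega

/-- The faces of `westSeg F` are `F` and its western neighbour. [folklore] -/
theorem faces_westSeg (F : Pt) :
    (lf (westSeg F) = (F.1 - 1, F.2) ∧ rf (westSeg F) = F) ∨ (lf (westSeg F) = F ∧ rf (westSeg F) = (F.1 - 1, F.2)) := by
  obtain ⟨x, y⟩ := F
  unfold westSeg
  split_ifs with h
  · left; exact ⟨lf_north x y, rf_north x y⟩
  · right
    have e1 := lf_south x (y + 1)
    have e2 := rf_south x (y + 1)
    simp only [add_sub_cancel_right] at e1 e2
    exact ⟨e1, e2⟩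

/-- The faces of `southSeg F` are `F` and its southern neighbour. [folklore] -/
theorem faces_southSeg (F : Pt) :
    (lf (southSeg F) = (F.1, F.2 - 1) ∧ rf (southSeg F) = F) ∨ (lf (southSeg F) = F ∧ rf (southSeg F) = (F.1, F.2 - 1)) := by
  obtain ⟨x, y⟩ := F
  unfold southSeg
  split_ifs with h
  · left
    have e1 := lf_west (x + 1) y
    have e2 := rf_west (x + 1) y
    simp only [add_sub_cancel_right] at e1 e2
    exact ⟨e1, e2⟩
  · right; exact ⟨lf_east x y, rf_east x y⟩

/-- A west segment dart is vertical, a south segment dart horizontal: they never coincide.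
[folklore] -/
theorem westSeg_ne_southSeg (F G : Pt) : westSeg F ≠ southSeg G := by
  unfold westSeg southSeg
  split_ifs <;> simp only [ne_eq, Prod.mk.injEq] <;> omega

/-- If the winding number differs between a face and its western neighbour, the west segment dart
lies on the walk. [folklore] -/
theorem westSeg_mem_of_ne (hl : ∀ e ∈ cdarts l, IsDart e.1 e.2) {F : Pt}
    (h : wnd l F ≠ wnd l (F.1 - 1, F.2)) : westSeg F ∈ cdarts l := by
  by_contra hn
  have := wnd_lf_eq_rf hl (isDart_westSeg F) hn
  rcases faces_westSeg F with ⟨h1, h2⟩ | ⟨h1, h2⟩ <;> rw [h1, h2] at this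
  · exact h this.symm
  · exact h this

/-- If the winding number differs between a face and its southern neighbour, the south segment
dart lies on the walk. [folklore] -/
theorem southSeg_mem_of_ne (hl : ∀ e ∈ cdarts l, IsDart e.1 e.2) {F : Pt}
    (h : wnd l F ≠ wnd l (F.1, F.2 - 1)) : southSeg F ∈ cdarts l := by
  by_contra hn
  have := wnd_lf_eq_rf hl (isDart_southSeg F) hn
  rcases faces_southSeg F with ⟨h1, h2⟩ | ⟨h1, h2⟩ <;> rw [h1, h2] at this
  · exact h this.symm
  · exact h this

/-! ### Tubes: the winding number of another trail along a walk avoiding it -/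

/-- Two consecutive darts of the graph share a face: the wedge of the turn. [folklore] -/
theorem wedge {u v w : Pt} (h1 : IsDart u v) (h2 : IsDart v w) :
    lf (u, v) = lf (v, w) ∨ rf (u, v) = rf (v, w) := by
  obtain ⟨a, b⟩ := u; obtain ⟨c, d⟩ := v; obtain ⟨e, f⟩ := w
  simp only [IsDart] at h1 h2
  simp only [lf, rf]
  split_ifs <;> simp only [Prod.mk.injEq] <;> omega

/-- **Tube lemma**: along two consecutive darts of the graph that are not darts of the closed walk
`l`, the winding number of `l` takes one value on the four adjacent faces. [folklore] -/
theorem tube (hl : ∀ e ∈ cdarts l, IsDart e.1 e.2) {u v w : Pt} (h1 : IsDart u v) (h2 : IsDart v w)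
    (n1 : (u, v) ∉ cdarts l) (n2 : (v, w) ∉ cdarts l) :
    wnd l (lf (u, v)) = wnd l (rf (u, v)) ∧ wnd l (lf (v, w)) = wnd l (rf (u, v)) ∧
      wnd l (rf (v, w)) = wnd l (rf (u, v)) := by
  have e1 := wnd_lf_eq_rf hl (d := (u, v)) h1 n1
  have e2 := wnd_lf_eq_rf hl (d := (v, w)) h2 n2
  rcases wedge h1 h2 with h | h
  · exact ⟨e1, by rw [← h, e1], by rw [← e2, ← h, e1]⟩
  · exact ⟨e1, by rw [e2, ← h], by rw [← h]⟩

/-- **Tube lemma along a walk**: if no dart of the walk `W` (consecutive vertices joined by darts of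
the graph) is a dart of the closed walk `l`, the winding number of `l` takes one value on all faces
adjacent to the darts of `W`. [folklore] -/
theorem tube_chain (hl : ∀ e ∈ cdarts l, IsDart e.1 e.2) :
    ∀ (W : List Pt), 2 ≤ W.length → (∀ d ∈ pdarts W, IsDart d.1 d.2) → (∀ d ∈ pdarts W, d ∉ cdarts l) →
      ∃ a : ℤ, ∀ d ∈ pdarts W, wnd l (lf d) = a ∧ wnd l (rf d) = a
  | [], h, _, _ => by simp at h
  | [_], h, _, _ => by simp at h
  | [u, v], _, hD, hN => by
    refine ⟨wnd l (rf (u, v)), ?_⟩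
    intro d hd
    simp only [pdarts_cons_cons, pdarts_singleton, List.mem_singleton] at hd
    subst hd
    exact ⟨wnd_lf_eq_rf hl (hD _ (by simp)) (hN _ (by simp)), rfl⟩
  | u :: v :: w :: W, _, hD, hN => by
    obtain ⟨a, ha⟩ := tube_chain hl (v :: w :: W) (by simp) (fun d hd => hD d (List.mem_cons_of_mem _ hd))
      (fun d hd => hN d (List.mem_cons_of_mem _ hd))
    have ht := tube hl (hD (u, v) (by simp)) (hD (v, w) (by simp)) (hN (u, v) (by simp)) (hN (v, w) (by simp))
    have hvw := ha (v, w) (by simp)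
    refine ⟨a, ?_⟩
    intro d hd
    rw [pdarts_cons_cons, List.mem_cons] at hd
    rcases hd with rfl | hd
    · refine ⟨?_, ?_⟩
      · rw [ht.1, ← ht.2.1, hvw.1]
      · rw [← ht.2.1, hvw.1]
    · exact ha d hd

/-! ### Exits of bounded face sets; the two-trails lemma -/

/-- A nonempty set of faces bounded to the west has a western exit. [folklore] -/
theorem exists_west_exit {K : Pt → Prop} (hK : ∃ m : ℤ, ∀ F, K F → m ≤ F.1) {F₀ : Pt} (h₀ : K F₀) :
    ∃ G, K G ∧ ¬ K (G.1 - 1, G.2) := by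
  by_contra h
  push Not at h
  obtain ⟨m, hm⟩ := hK
  have : ∀ n : ℕ, K (F₀.1 - n, F₀.2) := by
    intro n
    induction n with
    | zero => simpa using h₀
    | succ n ih => have := h _ ih; push_cast; rwa [sub_add_eq_sub_sub]
  have := hm _ (this (F₀.1 - m + 1).toNat)
  simp only at this
  omega

/-- A nonempty set of faces bounded to the south has a southern exit. [folklore] -/
theorem exists_south_exit {K : Pt → Prop} (hK : ∃ m : ℤ, ∀ F, K F → m ≤ F.2) {F₀ : Pt} (h₀ : K F₀) :
    ∃ G, K G ∧ ¬ K (G.1, G.2 - 1) := by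
  by_contra h
  push Not at h
  obtain ⟨m, hm⟩ := hK
  have : ∀ n : ℕ, K (F₀.1, F₀.2 - n) := by
    intro n
    induction n with
    | zero => simpa using h₀
    | succ n ih => have := h _ ih; push_cast; rwa [sub_add_eq_sub_sub]
  have := hm _ (this (F₀.2 - m + 1).toNat)
  simp only at this
  omega

/-- A trail has two distinct darts; in particular a dart other than any given one. [folklore] -/
theorem IsTrail.exists_dart_ne (hl : IsTrail l) (g : Pt × Pt) : ∃ d ∈ cdarts l, d ≠ g := by
  have h4 := hl.four_le_length
  have hlen : 2 ≤ (cdarts l).length := by simp; omega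
  have hne : (cdarts l)[0]'(by omega) ≠ (cdarts l)[1]'(by omega) := by
    intro h
    have := (List.Nodup.getElem_inj_iff hl.2.1).1 h
    simp at this
  by_cases h0 : (cdarts l)[0]'(by omega) = g
  · exact ⟨_, List.getElem_mem (by omega), fun h1 => hne (h0.trans h1.symm)⟩
  · exact ⟨_, List.getElem_mem (by omega), h0⟩

/-- **Two-trails lemma** (the planar-topology core: two closed trails of the oriented medial graph
that touch without crossing are nested or disjoint). Let `A`, `B` be closed trails such that the
winding number of `A` is the constant `α` on the faces along `B` and that of `B` is the constant
`β` along `A` (one dart `g` may be exempted). Then `α = 0` or `β = 0`, and no face has both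
`wnd A ≠ α` and `wnd B ≠ β`: the set of such faces has no boundary segment except the one
carrying `g`, and a bounded nonempty face set has both a western and a southern exit.
[folklore] -/
theorem two_trails {A B : List Pt} (hA : IsTrail A) (hB : IsTrail B) (g : Pt × Pt) (α β : ℤ)
    (hAB : ∀ d ∈ cdarts B, d ≠ g → wnd A (lf d) = α ∧ wnd A (rf d) = α)
    (hBA : ∀ d ∈ cdarts A, d ≠ g → wnd B (lf d) = β ∧ wnd B (rf d) = β) :
    (α = 0 ∨ β = 0) ∧ ∀ F, wnd A F = α ∨ wnd B F = β := by
  -- the boundary claim, west and south versions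
  set K : Pt → Prop := fun F => wnd A F ≠ α ∧ wnd B F ≠ β with hK
  have claimW : ∀ F : Pt, (K F ↔ ¬ K (F.1 - 1, F.2)) → westSeg F = g := by
    intro F hF
    by_contra hg
    have key : ∀ F₁ F₂ : Pt, K F₁ → ¬ K F₂ →
        ((F₁ = F ∧ F₂ = (F.1 - 1, F.2)) ∨ (F₁ = (F.1 - 1, F.2) ∧ F₂ = F)) → False := by
      intro F₁ F₂ h1 h2 h12
      have hF₁ : F₁ = lf (westSeg F) ∨ F₁ = rf (westSeg F) := by
        rcases faces_westSeg F with ⟨e1, e2⟩ | ⟨e1, e2⟩ <;> rw [e1, e2] <;>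
        rcases h12 with ⟨rfl, -⟩ | ⟨rfl, -⟩ <;> simp
      simp only [hK, not_and_or, not_not] at h2
      rcases h2 with h2 | h2
      · have hne : wnd A F ≠ wnd A (F.1 - 1, F.2) := by
          rcases h12 with ⟨rfl, rfl⟩ | ⟨rfl, rfl⟩
          · rw [h2]; exact h1.1
          · rw [h2]; exact h1.1.symm
        have hm := westSeg_mem_of_ne hA.2.2 hne
        have := hBA _ hm hg
        rcases hF₁ with rfl | rfl
        · exact h1.2 this.1
        · exact h1.2 this.2
      · have hne : wnd B F ≠ wnd B (F.1 - 1, F.2) := by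
          rcases h12 with ⟨rfl, rfl⟩ | ⟨rfl, rfl⟩
          · rw [h2]; exact h1.2
          · rw [h2]; exact h1.2.symm
        have hm := westSeg_mem_of_ne hB.2.2 hne
        have := hAB _ hm hg
        rcases hF₁ with rfl | rfl
        · exact h1.1 this.1
        · exact h1.1 this.2
    by_cases h : K F
    · exact key F _ h (hF.1 h) (Or.inl ⟨rfl, rfl⟩)
    · exact key _ F (by by_contra h'; exact h (hF.2 h')) h (Or.inr ⟨rfl, rfl⟩)
  have claimS : ∀ F : Pt, (K F ↔ ¬ K (F.1, F.2 - 1)) → southSeg F = g := by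
    intro F hF
    by_contra hg
    have key : ∀ F₁ F₂ : Pt, K F₁ → ¬ K F₂ →
        ((F₁ = F ∧ F₂ = (F.1, F.2 - 1)) ∨ (F₁ = (F.1, F.2 - 1) ∧ F₂ = F)) → False := by
      intro F₁ F₂ h1 h2 h12
      have hF₁ : F₁ = lf (southSeg F) ∨ F₁ = rf (southSeg F) := by
        rcases faces_southSeg F with ⟨e1, e2⟩ | ⟨e1, e2⟩ <;> rw [e1, e2] <;>
        rcases h12 with ⟨rfl, -⟩ | ⟨rfl, -⟩ <;> simp
      simp only [hK, not_and_or, not_not] at h2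
      rcases h2 with h2 | h2
      · have hne : wnd A F ≠ wnd A (F.1, F.2 - 1) := by
          rcases h12 with ⟨rfl, rfl⟩ | ⟨rfl, rfl⟩
          · rw [h2]; exact h1.1
          · rw [h2]; exact h1.1.symm
        have hm := southSeg_mem_of_ne hA.2.2 hne
        have := hBA _ hm hg
        rcases hF₁ with rfl | rfl
        · exact h1.2 this.1
        · exact h1.2 this.2
      · have hne : wnd B F ≠ wnd B (F.1, F.2 - 1) := by
          rcases h12 with ⟨rfl, rfl⟩ | ⟨rfl, rfl⟩
          · rw [h2]; exact h1.2
          · rw [h2]; exact h1.2.symm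
        have hm := southSeg_mem_of_ne hB.2.2 hne
        have := hAB _ hm hg
        rcases hF₁ with rfl | rfl
        · exact h1.1 this.1
        · exact h1.1 this.2
    by_cases h : K F
    · exact key F _ h (hF.1 h) (Or.inl ⟨rfl, rfl⟩)
    · exact key _ F (by by_contra h'; exact h (hF.2 h')) h (Or.inr ⟨rfl, rfl⟩)
  obtain ⟨mA, hmA⟩ := exists_bound_of_wnd A
  obtain ⟨mB, hmB⟩ := exists_bound_of_wnd B
  -- first conclusion: the complement of `K` is bounded and nonempty if `α ≠ 0 ≠ β`
  have h1 : α = 0 ∨ β = 0 := by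
    by_contra hαβ
    push Not at hαβ
    set K' : Pt → Prop := fun F => ¬ K F with hK'
    have hbd1 : ∃ m : ℤ, ∀ F, K' F → m ≤ F.1 := by
      refine ⟨min mA mB, fun F hF => ?_⟩
      simp only [hK', hK, not_and_or, not_not] at hF
      rcases hF with hF | hF
      · exact (min_le_left _ _).trans (hmA F (by rw [hF]; exact hαβ.1)).1
      · exact (min_le_right _ _).trans (hmB F (by rw [hF]; exact hαβ.2)).1
    have hbd2 : ∃ m : ℤ, ∀ F, K' F → m ≤ F.2 := by
      refine ⟨min mA mB, fun F hF => ?_⟩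
      simp only [hK', hK, not_and_or, not_not] at hF
      rcases hF with hF | hF
      · exact (min_le_left _ _).trans (hmA F (by rw [hF]; exact hαβ.1)).2
      · exact (min_le_right _ _).trans (hmB F (by rw [hF]; exact hαβ.2)).2
    -- a face along `B` (off `g`) lies in `K'`
    obtain ⟨d, hd, hdg⟩ := hB.exists_dart_ne g
    have hF₀ : K' (lf d) := by
      simp only [hK', hK, not_and_or, not_not]; exact Or.inl (hAB d hd hdg).1
    obtain ⟨G, hG, hG'⟩ := exists_west_exit hbd1 hF₀
    obtain ⟨G₂, hG₂, hG₂'⟩ := exists_south_exit hbd2 hF₀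
    have e1 := claimW G (by simp only [hK'] at hG hG'; tauto)
    have e2 := claimS G₂ (by simp only [hK'] at hG₂ hG₂'; tauto)
    exact westSeg_ne_southSeg G G₂ (e1.trans e2.symm)
  refine ⟨h1, ?_⟩
  -- second conclusion: `K` is bounded, hence empty
  intro F₀
  by_contra hF₀
  rw [not_or] at hF₀
  have hbd1 : ∃ m : ℤ, ∀ F, K F → m ≤ F.1 := by
    rcases h1 with rfl | rfl
    · exact ⟨mA, fun F hF => (hmA F hF.1).1⟩
    · exact ⟨mB, fun F hF => (hmB F hF.2).1⟩
  have hbd2 : ∃ m : ℤ, ∀ F, K F → m ≤ F.2 := by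
    rcases h1 with rfl | rfl
    · exact ⟨mA, fun F hF => (hmA F hF.1).2⟩
    · exact ⟨mB, fun F hF => (hmB F hF.2).2⟩
  obtain ⟨G, hG, hG'⟩ := exists_west_exit hbd1 (F₀ := F₀) hF₀
  obtain ⟨G₂, hG₂, hG₂'⟩ := exists_south_exit hbd2 (F₀ := F₀) hF₀
  have e1 := claimW G (by tauto)
  have e2 := claimS G₂ (by tauto)
  exact westSeg_ne_southSeg G G₂ (e1.trans e2.symm)

end Typed

/-! ### The invariant: turning number `±4` and the sign pattern of the winding number -/

section Invariant

variable {l : List Pt}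

/-- **The induction invariant.** A closed trail is *positive* if its turning number is `4` and its
winding number takes only the values `0, 1`, and *negative* if its turning number is `-4` and its
winding number takes only the values `0, -1`; the combinatorial Umlaufsatz says every closed trail
of the oriented medial graph is one or the other. [cite: Hopf1935, Satz I] -/
def INV (l : List Pt) : Prop :=
  (cturn l = 4 ∧ ∀ F, wnd l F = 0 ∨ wnd l F = 1) ∨ (cturn l = -4 ∧ ∀ F, wnd l F = 0 ∨ wnd l F = -1)

/-- The invariant is invariant under rotation of the cycle. [folklore] -/
theorem inv_rotate_iff (h3 : 3 ≤ l.length) (k : ℕ) : INV (l.rotate k) ↔ INV l := by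
  simp only [INV, cturn_rotate h3, wnd_rotate]

/-- The two types of a trail satisfying the invariant, read off at any of its darts: the face on
the right has winding number `0` (positive type) or `-1` (negative type). [folklore] -/
theorem INV.rf_cases (hI : INV l) (hl : IsTrail l) {d : Pt × Pt} (hd : d ∈ cdarts l) :
    (wnd l (rf d) = 0 ∧ wnd l (lf d) = 1 ∧ cturn l = 4 ∧ ∀ F, wnd l F = 0 ∨ wnd l F = 1) ∨
    (wnd l (rf d) = -1 ∧ wnd l (lf d) = 0 ∧ cturn l = -4 ∧ ∀ F, wnd l F = 0 ∨ wnd l F = -1) := by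
  have hj := hl.wnd_lf hd
  rcases hI with ⟨hc, hv⟩ | ⟨hc, hv⟩
  · have h1 := hv (rf d); have h2 := hv (lf d)
    exact Or.inl ⟨by omega, by omega, hc, hv⟩
  · have h1 := hv (rf d); have h2 := hv (lf d)
    exact Or.inr ⟨by omega, by omega, hc, hv⟩

/-! ### The base case: trails of length four are unit squares -/

/-- The darts of a four-element cyclic list. [folklore] -/
theorem cdarts_four (P₀ P₁ P₂ P₃ : Pt) :
    cdarts [P₀, P₁, P₂, P₃] = [(P₀, P₁), (P₁, P₂), (P₂, P₃), (P₃, P₀)] := rfl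

/-- **Base case.** A closed trail of length four starting at an even vertex is a unit square: around
an odd face counterclockwise (positive type) or around an even face clockwise (negative type).
[folklore] -/
theorem inv_four_even {P₀ P₁ P₂ P₃ : Pt} (hl : IsTrail [P₀, P₁, P₂, P₃]) (h0 : (P₀.1 + P₀.2) % 2 = 0) :
    INV [P₀, P₁, P₂, P₃] := by
  obtain ⟨-, -, hD⟩ := hl
  have h01 := hD (P₀, P₁) (by simp [cdarts_four])
  have h12 := hD (P₁, P₂) (by simp [cdarts_four])
  have h23 := hD (P₂, P₃) (by simp [cdarts_four])
  have h30 := hD (P₃, P₀) (by simp [cdarts_four])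
  clear hD
  have p1 := h01.parity; have p2 := h12.parity; have p3 := h23.parity
  obtain ⟨a, b⟩ := P₀; obtain ⟨c, d⟩ := P₁; obtain ⟨e, f⟩ := P₂; obtain ⟨g, k⟩ := P₃
  simp only at h0 p1 p2 p3 h01 h12 h23 h30
  have q1 : (c + d) % 2 = 1 := by clear h12 h23 h30 p2 p3; omega
  have q2 : (e + f) % 2 = 0 := by clear h01 h12 h23 h30 p3; omega
  have q3 : (g + k) % 2 = 1 := by clear h01 h12 h23 h30; omega
  simp only [IsDart, h0, q1, q2, q3, true_and, false_and, 
    false_or, or_false, Int.reduceEq] at h01 h12 h23 h30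
  clear p1 p2 p3 q1 q2 q3 h0
  have hc : c = a := h01.1
  have hdb : d = b + 1 ∨ d = b - 1 := h01.2
  subst c
  have hf : f = d := h12.1
  have hea : e = a + 1 ∨ e = a - 1 := h12.2
  subst f
  have hg : g = e := h23.1
  have hk : k = b := by clear h01 h12 h23; omega
  subst g k
  clear h01 h12 h23 h30
  rcases hdb with rfl | rfl <;> rcases hea with rfl | rfl
  · -- north, east, south, west: clockwise around the even face `(c, b)`
    right
    refine ⟨?_, fun F => ?_⟩
    · simp only [cturn, List.take_succ_cons, List.take_zero, List.cons_append, List.nil_append,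
        pturn_cons₃, pturn_two, turn]
      split_ifs <;> omega
    · obtain ⟨x, y⟩ := F
      simp only [wnd, dwnd, cdarts_four, List.map_cons, List.map_nil, List.sum_cons, List.sum_nil,
        dartWnd, true_and]
      split_ifs <;> omega
  · -- north, west, south, east: counterclockwise around the odd face `(c - 1, b)`
    left
    refine ⟨?_, fun F => ?_⟩
    · simp only [cturn, List.take_succ_cons, List.take_zero, List.cons_append, List.nil_append,
        pturn_cons₃, pturn_two, turn]
      split_ifs <;> omega
    · obtain ⟨x, y⟩ := F
      simp only [wnd, dwnd, cdarts_four, List.map_cons, List.map_nil, List.sum_cons, List.sum_nil,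
        dartWnd, true_and]
      split_ifs <;> omega
  · -- south, east, north, west: counterclockwise around the odd face `(c, b - 1)`
    left
    refine ⟨?_, fun F => ?_⟩
    · simp only [cturn, List.take_succ_cons, List.take_zero, List.cons_append, List.nil_append,
        pturn_cons₃, pturn_two, turn]
      split_ifs <;> omega
    · obtain ⟨x, y⟩ := F
      simp only [wnd, dwnd, cdarts_four, List.map_cons, List.map_nil, List.sum_cons, List.sum_nil,
        dartWnd, true_and]
      split_ifs <;> omega
  · -- south, west, north, east: clockwise around the even face `(c - 1, b - 1)`
    right
    refine ⟨?_, fun F => ?_⟩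
    · simp only [cturn, List.take_succ_cons, List.take_zero, List.cons_append, List.nil_append,
        pturn_cons₃, pturn_two, turn]
      split_ifs <;> omega
    · obtain ⟨x, y⟩ := F
      simp only [wnd, dwnd, cdarts_four, List.map_cons, List.map_nil, List.sum_cons, List.sum_nil,
        dartWnd, true_and]
      split_ifs <;> omega

/-- **Base case**: every closed trail of length four satisfies the invariant. [folklore] -/
theorem inv_of_length_four (hl : IsTrail l) (h4 : l.length = 4) : INV l := by
  obtain ⟨P₀, P₁, P₂, P₃, rfl⟩ : ∃ P₀ P₁ P₂ P₃, l = [P₀, P₁, P₂, P₃] := by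
    match l, h4 with
    | [P₀, P₁, P₂, P₃], _ => exact ⟨P₀, P₁, P₂, P₃, rfl⟩
  rcases Int.emod_two_eq_zero_or_one (P₀.1 + P₀.2) with h0 | h0
  · exact inv_four_even hl h0
  · have h01 := hl.2.2 (P₀, P₁) (by simp [cdarts_four])
    have h1 : (P₁.1 + P₁.2) % 2 = 0 := by
      have := h01.parity; simp only at this; omega
    have := inv_four_even (hl.rotate 1) h1
    exact (inv_rotate_iff (by simp) 1).1 this

/-! ### Local geometry at a vertex passed twice -/

/-- **Local coordinates at a vertex with two in-darts and two out-darts**: the in-darts come from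
opposite sides, the out-darts leave to the two other (opposite) sides. [folklore] -/
theorem local_geom {u u' P w w' : Pt} (hu : IsDart u P) (hu' : IsDart u' P) (huu' : u ≠ u')
    (hw : IsDart P w) (hw' : IsDart P w') (hww' : w ≠ w') :
    ∃ a b s t : ℤ, (s = 1 ∨ s = -1) ∧ (t = 1 ∨ t = -1) ∧ P = (a, b) ∧
      ((u = (a - s, b) ∧ u' = (a + s, b) ∧ w = (a, b + t) ∧ w' = (a, b - t)) ∨
       (u = (a, b - s) ∧ u' = (a, b + s) ∧ w = (a + t, b) ∧ w' = (a - t, b))) := by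
  have pu := hu.parity; have pu' := hu'.parity; have pw := hw.parity; have pw' := hw'.parity
  obtain ⟨a, b⟩ := P
  obtain ⟨ua, ub⟩ := u; obtain ⟨ua', ub'⟩ := u'; obtain ⟨wa, wb⟩ := w; obtain ⟨wa', wb'⟩ := w'
  simp only [ne_eq, Prod.mk.injEq, not_and] at huu' hww'
  simp only at pu pu' pw pw'
  rcases Int.emod_two_eq_zero_or_one (a + b) with hp | hp
  · have qu : (ua + ub) % 2 = 1 := by clear pu' pw pw' hu hu' hw hw'; omega
    have qu' : (ua' + ub') % 2 = 1 := by clear pu pw pw' hu hu' hw hw' qu; omega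
    simp only [IsDart, hp, qu, qu', true_and, false_and, 
      false_or, or_false, Int.reduceEq] at hu hu' hw hw'
    clear pu pu' pw pw' qu qu' hp
    refine ⟨a, b, a - ua, wb - b, ?_, ?_, rfl, Or.inl ⟨?_, ?_, ?_, ?_⟩⟩
    all_goals first | omega | (simp only [Prod.mk.injEq]; omega)
  · have qu : (ua + ub) % 2 = 0 := by clear pu' pw pw' hu hu' hw hw'; omega
    have qu' : (ua' + ub') % 2 = 0 := by clear pu pw pw' hu hu' hw hw' qu; omega
    simp only [IsDart, hp, qu, qu', true_and, false_and, 
      false_or, or_false, Int.reduceEq] at hu hu' hw hw'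
    clear pu pu' pw pw' qu qu' hp
    refine ⟨a, b, b - ub, wa - a, ?_, ?_, rfl, Or.inr ⟨?_, ?_, ?_, ?_⟩⟩
    all_goals first | omega | (simp only [Prod.mk.injEq]; omega)

/-- **The four turns at a vertex passed twice.** With in-darts `u → P`, `u' → P` and out-darts
`P → w`, `P → w'`: the pairings `(u, w)` and `(u', w')` turn the same way `t = ±1`, the cross
pairings turn the other way. [folklore] -/
theorem local_turns {u u' P w w' : Pt} (hu : IsDart u P) (hu' : IsDart u' P) (huu' : u ≠ u')
    (hw : IsDart P w) (hw' : IsDart P w') (hww' : w ≠ w') :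
    (turn u P w = 1 ∨ turn u P w = -1) ∧ turn u' P w' = turn u P w ∧
      turn u' P w = -turn u P w ∧ turn u P w' = -turn u P w := by
  obtain ⟨a, b, s, t, hs, ht, rfl, h⟩ := local_geom hu hu' huu' hw hw' hww'
  rcases h with ⟨rfl, rfl, rfl, rfl⟩ | ⟨rfl, rfl, rfl, rfl⟩ <;>
  · simp only [turn]
    split_ifs <;> omega

/-- **Wedge and far faces at a vertex passed twice.** If `u → P → w` turns left, the left faces of
its two darts coincide (the wedge) and the right face of `P → w` is the right face of the opposite
in-dart `u' → P`; symmetrically for a right turn. [folklore] -/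
theorem far_face {u u' P w w' : Pt} (hu : IsDart u P) (hu' : IsDart u' P) (huu' : u ≠ u')
    (hw : IsDart P w) (hw' : IsDart P w') (hww' : w ≠ w') :
    (turn u P w = 1 ∧ lf (P, w) = lf (u, P) ∧ rf (P, w) = rf (u', P)) ∨
      (turn u P w = -1 ∧ rf (P, w) = rf (u, P) ∧ lf (P, w) = lf (u', P)) := by
  obtain ⟨a, b, s, t, hs, ht, rfl, h⟩ := local_geom hu hu' huu' hw hw' hww'
  rcases h with ⟨rfl, rfl, rfl, rfl⟩ | ⟨rfl, rfl, rfl, rfl⟩ <;>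
  rcases hs with rfl | rfl <;> rcases ht with rfl | rfl <;>
  · simp only [turn, lf, rf]
    first
    | (left; refine ⟨?_, ?_, ?_⟩ <;> split_ifs <;>
        (try simp only [Prod.mk.injEq, true_and, and_true]) <;> omega)
    | (right; refine ⟨?_, ?_, ?_⟩ <;> split_ifs <;>
        (try simp only [Prod.mk.injEq, true_and, and_true]) <;> omega)

/-! ### Splitting a closed trail at a vertex passed twice -/

/-- The closing dart of a nonempty cyclic list. [folklore] -/
theorem getLast_head_mem_cdarts (h : l ≠ []) : (l.getLast h, l.head h) ∈ cdarts l := by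
  rw [cdarts_eq h]; simp

/-- The first dart of a cyclic list with at least two vertices. [folklore] -/
theorem head_mem_cdarts (h : 2 ≤ l.length) :
    (l.head (List.ne_nil_of_length_pos (by omega)), l[1]'(by omega)) ∈ cdarts l := by
  refine mem_cdarts_iff.2 ⟨0, by omega, ?_⟩
  simp only [Prod.mk.injEq]
  refine ⟨(List.head_eq_getElem _).trans rfl, ?_⟩
  congr 1
  rw [Nat.zero_add, Nat.mod_eq_of_lt (by omega)]

/-- The left piece of a trail split at a repeated vertex is a trail. [folklore] -/
theorem IsTrail.left {A B : List Pt} (hl : IsTrail (A ++ B)) (hA0 : A ≠ []) (hB0 : B ≠ [])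
    (hh : A.head hA0 = B.head hB0) : IsTrail A := by
  have hcd := cdarts_append_of_head_eq A B hA0 hB0 hh
  refine ⟨hA0, (List.nodup_append.1 (hcd ▸ hl.2.1)).1, fun d hd => hl.2.2 d ?_⟩
  rw [hcd]; exact List.mem_append_left _ hd

/-- The right piece of a trail split at a repeated vertex is a trail. [folklore] -/
theorem IsTrail.right {A B : List Pt} (hl : IsTrail (A ++ B)) (hA0 : A ≠ []) (hB0 : B ≠ [])
    (hh : A.head hA0 = B.head hB0) : IsTrail B := by
  have hcd := cdarts_append_of_head_eq A B hA0 hB0 hh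
  refine ⟨hB0, (List.nodup_append.1 (hcd ▸ hl.2.1)).2.1, fun d hd => hl.2.2 d ?_⟩
  rw [hcd]; exact List.mem_append_right _ hd

/-- **Splitting step of the Umlaufsatz.** If a closed trail passes a vertex twice, write it as
`A ++ B` with both pieces starting there; if both pieces (closed trails themselves) satisfy the
invariant, so does the whole trail. The turning numbers satisfy `τ = τ_A + τ_B - 4t` (`t` the
common turn of the two pieces at the vertex), the winding numbers add, the winding number of each
piece is constant along the other (tube lemma), the constants are determined by `t` and the types
(far faces), and the two-trails lemma excludes the sign patterns that would give `τ = ±12` or a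
winding number outside `{0, ±1}`. [folklore] -/
theorem inv_append {A B : List Pt} (hl : IsTrail (A ++ B)) (hA0 : A ≠ []) (hB0 : B ≠ [])
    (hh : A.head hA0 = B.head hB0) (hIA : INV A) (hIB : INV B) : INV (A ++ B) := by
  have hcd := cdarts_append_of_head_eq A B hA0 hB0 hh
  have hnd : (cdarts A ++ cdarts B).Nodup := hcd ▸ hl.2.1
  have hdisj := List.disjoint_of_nodup_append hnd
  have hA := hl.left hA0 hB0 hh
  have hB := hl.right hA0 hB0 hh
  have hA4 := hA.four_le_length
  have hB4 := hB.four_le_length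
  -- the four darts at the repeated vertex `P = A.head = B.head`: `u → P`, `u' → P`, `P → w`,
  -- `P → w'` with `u = A.getLast`, `u' = B.getLast`, `w = A[1]`, `w' = B[1]`
  have h1A : 1 < A.length := by omega
  have h1B : 1 < B.length := by omega
  have ha_in : (A.getLast hA0, A.head hA0) ∈ cdarts A := getLast_head_mem_cdarts hA0
  have hb_in : (B.getLast hB0, A.head hA0) ∈ cdarts B := by
    rw [hh]; exact getLast_head_mem_cdarts hB0
  have ha_out : (A.head hA0, A[1]'h1A) ∈ cdarts A := head_mem_cdarts (by omega)
  have hb_out : (A.head hA0, B[1]'h1B) ∈ cdarts B := by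
    rw [hh]; exact head_mem_cdarts (by omega)
  have hne : A.getLast hA0 ≠ B.getLast hB0 := by
    intro h; exact hdisj ha_in (by rw [h]; exact hb_in)
  have hne' : A[1]'h1A ≠ B[1]'h1B := by
    intro h; exact hdisj ha_out (by rw [h]; exact hb_out)
  have du := hA.2.2 _ ha_in; have du' := hB.2.2 _ hb_in
  have dw := hA.2.2 _ ha_out; have dw' := hB.2.2 _ hb_out
  simp only at du du' dw dw'
  obtain ⟨ht, htt, ht1, ht2⟩ := local_turns du du' hne dw dw' hne'
  -- turning numbers
  have h0A : 0 < A.length := by omega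
  have h0B : 0 < B.length := by omega
  have hA0' : A[0]'h0A = A.head hA0 := (List.head_eq_getElem hA0).symm
  have hB0' : B[0]'h0B = A.head hA0 := by rw [hh]; exact (List.head_eq_getElem hB0).symm
  have hct : cturn (A ++ B) = cturn A + cturn B - (4 : ℤ) * turn (A.getLast hA0) (A.head hA0) (A[1]'h1A) := by
    have e0 : cturn (A ++ B) = pturn (B.getLast hB0 :: A ++ [B.head hB0]) +
        pturn (A.getLast hA0 :: B ++ [A.head hA0]) := cturn_split A B (by omega) hB0
    have eA : cturn A = pturn (A.getLast hA0 :: A ++ [A.head hA0]) := cturn_eq_pturn A (by omega)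
    have eB : cturn B = pturn (B.getLast hB0 :: B ++ [B.head hB0]) := cturn_eq_pturn B (by omega)
    have e1 : pturn (B.getLast hB0 :: A ++ [A.head hA0]) - pturn (A.getLast hA0 :: A ++ [A.head hA0]) =
        turn (B.getLast hB0) (A[0]'h0A) (A[1]'h1A) - turn (A.getLast hA0) (A[0]'h0A) (A[1]'h1A) :=
      pturn_cons_append_sub (B.getLast hB0) (A.getLast hA0) A (by omega) (A.head hA0)
    have e2 : pturn (A.getLast hA0 :: B ++ [A.head hA0]) - pturn (B.getLast hB0 :: B ++ [A.head hA0]) =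
        turn (A.getLast hA0) (B[0]'h0B) (B[1]'h1B) - turn (B.getLast hB0) (B[0]'h0B) (B[1]'h1B) :=
      pturn_cons_append_sub (A.getLast hA0) (B.getLast hB0) B (by omega) (A.head hA0)
    rw [hA0'] at e1; rw [hB0'] at e2
    rw [← hh] at e0 eB
    rw [e0]
    linarith
  -- tubes: the winding number of each piece is constant along the other
  have keyB : pdarts (B ++ [B.head hB0]) = cdarts B := by
    rw [pdarts_append_singleton _ hB0, cdarts_eq hB0]
  have keyA : pdarts (A ++ [A.head hA0]) = cdarts A := by
    rw [pdarts_append_singleton _ hA0, cdarts_eq hA0]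
  obtain ⟨α, hα⟩ := tube_chain hA.2.2 (B ++ [B.head hB0]) (by simp; omega)
    (by rw [keyB]; exact hB.2.2) (by rw [keyB]; exact fun d hd hdA => hdisj hdA hd)
  obtain ⟨β, hβ⟩ := tube_chain hB.2.2 (A ++ [A.head hA0]) (by simp; omega)
    (by rw [keyA]; exact hA.2.2) (by rw [keyA]; exact fun d hd hdB => hdisj hd hdB)
  rw [keyB] at hα; rw [keyA] at hβ
  have h2 := two_trails hA hB (A.getLast hA0, A.head hA0) α β (fun d hd _ => hα d hd)
    (fun d hd _ => hβ d hd)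
  have tA := hα _ hb_in
  have tB := hβ _ ha_in
  have jA1 := hA.wnd_lf ha_in; have jA2 := hA.wnd_lf ha_out
  have jB1 := hB.wnd_lf hb_in; have jB2 := hB.wnd_lf hb_out
  have cA := hIA.rf_cases hA ha_in
  have cB := hIB.rf_cases hB hb_in
  have ffA := far_face du du' hne dw dw' hne'
  have ffB := far_face du' du hne.symm dw' dw hne'.symm
  rw [htt] at ffB
  -- assemble
  have hw2 : ∀ F, wnd (A ++ B) F = wnd A F + wnd B F := wnd_append_of_head_eq A B hA0 hB0 hh
  unfold INV
  rw [hct]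
  simp only [hw2]
  rcases ffA with ⟨htA, f1, f2⟩ | ⟨htA, f1, f2⟩ <;> rcases ffB with ⟨htB, g1, g2⟩ | ⟨htB, g1, g2⟩ <;>
  have e1 := congrArg (wnd A) f1 <;> have e2 := congrArg (wnd A) f2 <;>
  have e3 := congrArg (wnd B) g1 <;> have e4 := congrArg (wnd B) g2 <;>
  rcases cA with ⟨ra, la, ca, va⟩ | ⟨ra, la, ca, va⟩ <;> rcases cB with ⟨rb, lb, cb, vb⟩ | ⟨rb, lb, cb, vb⟩ <;>
  first
  | (exfalso; omega)
  | (left; refine ⟨by omega, fun F => ?_⟩; have := h2.2 F; have := va F; have := vb F; omega)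
  | (right; refine ⟨by omega, fun F => ?_⟩; have := h2.2 F; have := va F; have := vb F; omega)

end Invariant

/-! ### The reflection `(x, y) ↦ (-x, y)` -/

section Reflect

variable {l : List Pt}

/-- Reflection in the vertical axis: an automorphism of the oriented medial graph (it preserves
the parity classes and the vertical/horizontal directions) reversing orientation. [folklore] -/
def refl (P : Pt) : Pt := (-P.1, P.2)

/-- `refl` is an involution. [folklore] -/
@[simp] theorem refl_refl (P : Pt) : refl (refl P) = P := by simp [refl]

/-- `refl` is injective. [folklore] -/
theorem refl_injective : Function.Injective refl := fun P Q h => by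
  simpa using congrArg refl h

/-- Reflection preserves darts. [folklore] -/
theorem isDart_refl {p q : Pt} : IsDart (refl p) (refl q) ↔ IsDart p q := by
  obtain ⟨a, b⟩ := p; obtain ⟨c, d⟩ := q
  simp only [IsDart, refl]
  constructor <;> intro h <;> omega

/-- Reflecting a list twice gives it back. [folklore] -/
@[simp] theorem map_refl_refl (l : List Pt) : (l.map refl).map refl = l := by
  simp [Function.comp_def]

/-- Darts of a mapped list. [folklore] -/
theorem cdarts_map (f : Pt → Pt) (l : List Pt) : cdarts (l.map f) = (cdarts l).map (Prod.map f f) := by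
  rw [cdarts, cdarts, ← List.map_rotate, List.zip_map]

/-- Membership of darts of the reflected list. [folklore] -/
theorem mem_cdarts_map_refl {p q : Pt} : (p, q) ∈ cdarts (l.map refl) ↔ (refl p, refl q) ∈ cdarts l := by
  rw [cdarts_map, List.mem_map]
  constructor
  · rintro ⟨⟨a, b⟩, h, he⟩
    simp only [Prod.map, Prod.mk.injEq] at he
    obtain ⟨rfl, rfl⟩ := he
    simpa using h
  · intro h
    exact ⟨(refl p, refl q), h, by simp⟩

/-- The reflection of a trail is a trail. [folklore] -/
theorem IsTrail.map_refl (hl : IsTrail l) : IsTrail (l.map refl) := by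
  refine ⟨by simpa using hl.1, ?_, ?_⟩
  · rw [cdarts_map]
    exact hl.2.1.map (Prod.map_injective.2 ⟨refl_injective, refl_injective⟩)
  · intro d hd
    rw [cdarts_map, List.mem_map] at hd
    obtain ⟨d', hd', rfl⟩ := hd
    exact isDart_refl.2 (hl.2.2 d' hd')

/-- Reflection reverses turns (of nondegenerate two-step paths). [folklore] -/
theorem turn_refl {u v w : Pt} (h : u ≠ v) : turn (refl u) (refl v) (refl w) = -turn u v w := by
  obtain ⟨a, b⟩ := u; obtain ⟨c, d⟩ := v; obtain ⟨e, f⟩ := w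
  simp only [ne_eq, Prod.mk.injEq, not_and] at h
  simp only [turn, refl]
  split_ifs <;> omega

/-- Reflection reverses the turn sum of a path with nondegenerate steps. [folklore] -/
theorem pturn_map_refl : ∀ (L : List Pt), (∀ d ∈ pdarts L, d.1 ≠ d.2) → pturn (L.map refl) = -pturn L
  | [], _ => by simp
  | [_], _ => by simp
  | [_, _], _ => by simp
  | a :: b :: c :: L, h => by
    rw [List.map_cons, List.map_cons, List.map_cons, pturn_cons₃, turn_refl (h (a, b) (by simp)),
      ← List.map_cons, ← List.map_cons,
      pturn_map_refl (b :: c :: L) (fun d hd => h d (List.mem_cons_of_mem _ hd)), pturn_cons₃]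
    ring

/-- **Reflection reverses the turning number** of a closed trail. [folklore] -/
theorem cturn_map_refl (hl : IsTrail l) : cturn (l.map refl) = -cturn l := by
  have h4 := hl.four_le_length
  have hne := hl.1
  have e1 : cturn l = pturn (l.getLast hne :: l ++ [l.head hne]) := cturn_eq_pturn l (by omega)
  have e2 : cturn (l.map refl) = pturn ((l.map refl).getLast (by simpa using hne) :: l.map refl ++
      [(l.map refl).head (by simpa using hne)]) := cturn_eq_pturn (l.map refl) (by simp; omega)
  rw [e1, e2, List.getLast_map, List.head_map,
    show refl (l.getLast hne) :: l.map refl ++ [refl (l.head hne)] = (l.getLast hne :: l ++ [l.head hne]).map refl by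
      simp]
  apply pturn_map_refl
  intro d hd
  have hd' : d ∈ cdarts l := by
    rw [List.cons_append, pdarts_cons_of_ne_nil _ (by simp), pdarts_append_singleton _ hne,
      List.head_append_of_ne_nil hne] at hd
    rw [cdarts_eq hne]
    simp only [List.mem_cons, List.mem_append] at hd ⊢
    tauto
  exact (hl.2.2 d hd').ne

/-- A reflected dart's winding contribution: the ray to the west of the reflected face is the
complement, within the row, of the ray to the west of the face `(-x - 1, y)`. [folklore] -/
theorem dartWnd_refl (d : Pt × Pt) (x y M : ℤ) (hM : d.1.1 ≤ M) :
    dartWnd (Prod.map refl refl d) (x, y) = dartWnd d (M, y) - dartWnd d (-x - 1, y) := by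
  obtain ⟨⟨a, b⟩, ⟨c, e⟩⟩ := d
  simp only at hM
  simp only [dartWnd, refl, Prod.map]
  split_ifs <;> omega

/-- **Reflection negates winding numbers** (at the reflected face): the total flux through a row
vanishes. [folklore] -/
theorem wnd_map_refl (hl : ∀ d ∈ cdarts l, IsDart d.1 d.2) (x y : ℤ) :
    wnd (l.map refl) (x, y) = -wnd l (-x - 1, y) := by
  obtain ⟨M, hM⟩ := exists_upper_bounds l
  have h0 : wnd l (M, y) = 0 := wnd_eq_zero_of_ge hl (fun P hP => (hM P hP).1)
  have key : ∀ D : List (Pt × Pt), (∀ d ∈ D, d.1 ∈ l) →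
      dwnd (D.map (Prod.map refl refl)) (x, y) = dwnd D (M, y) - dwnd D (-x - 1, y) := by
    intro D hD
    induction D with
    | nil => simp
    | cons d D ih =>
      rw [List.map_cons, dwnd_cons, dwnd_cons, dwnd_cons, ih (fun e he => hD e (List.mem_cons_of_mem _ he)),
        dartWnd_refl d x y M (hM _ (hD d (by simp))).1]
      ring
  rw [wnd, cdarts_map, key (cdarts l) (fun d hd => (mem_of_mem_cdarts hd).1)]
  change wnd l (M, y) - wnd l (-x - 1, y) = _
  rw [h0]; ring

/-- The invariant of the reflected trail gives the invariant (of the opposite type). [folklore] -/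
theorem inv_of_inv_map_refl (hl : IsTrail l) (h : INV (l.map refl)) : INV l := by
  have hc := cturn_map_refl hl
  have hw : ∀ F : Pt, wnd l F = -wnd (l.map refl) (-F.1 - 1, F.2) := by
    intro F
    have := wnd_map_refl (l := l.map refl) hl.map_refl.2.2 F.1 F.2
    rw [map_refl_refl] at this
    rw [show F = (F.1, F.2) from rfl, this]
  rcases h with ⟨hc', hv⟩ | ⟨hc', hv⟩
  · right
    refine ⟨by omega, fun F => ?_⟩
    have := hv (-F.1 - 1, F.2); have := hw F; omega
  · left
    refine ⟨by omega, fun F => ?_⟩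
    have := hv (-F.1 - 1, F.2); have := hw F; omega

end Reflect

/-! ### The potential: total height above the lowest vertex -/

section Potential

variable {l : List Pt}

/-- Minimum of a list of integers folded from an initial value: bounds. [folklore] -/
theorem foldr_min_le (L : List ℤ) (a : ℤ) : L.foldr min a ≤ a ∧ ∀ z ∈ L, L.foldr min a ≤ z := by
  induction L with
  | nil => simp
  | cons b L ih =>
    simp only [List.foldr_cons, List.mem_cons]
    refine ⟨(min_le_right _ _).trans ih.1, ?_⟩
    rintro z (rfl | hz)
    · exact min_le_left _ _
    · exact (min_le_right _ _).trans (ih.2 z hz)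

/-- Minimum of a list of integers folded from an initial value: attained. [folklore] -/
theorem foldr_min_mem (L : List ℤ) (a : ℤ) : L.foldr min a = a ∨ L.foldr min a ∈ L := by
  induction L with
  | nil => simp
  | cons b L ih =>
    simp only [List.foldr_cons, List.mem_cons]
    rcases min_choice b (L.foldr min a) with h | h <;> rw [h]
    · exact Or.inr (Or.inl rfl)
    · rcases ih with h' | h'
      · exact Or.inl h'
      · exact Or.inr (Or.inr h')

/-- The lowest height of a vertex of the list. [folklore] -/
def lo2 (l : List Pt) : ℤ := (l.map Prod.snd).foldr min ((l.map Prod.snd).headD 0)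

/-- `lo2` is a lower bound for the heights. [folklore] -/
theorem lo2_le {P : Pt} (hP : P ∈ l) : lo2 l ≤ P.2 :=
  (foldr_min_le _ _).2 _ (List.mem_map.2 ⟨P, hP, rfl⟩)

/-- `lo2` is attained (nonempty list). [folklore] -/
theorem lo2_mem (hl : l ≠ []) : ∃ P ∈ l, lo2 l = P.2 := by
  rcases foldr_min_mem (l.map Prod.snd) ((l.map Prod.snd).headD 0) with h | h
  · refine ⟨l.head hl, List.head_mem hl, ?_⟩
    rw [lo2, h]
    obtain ⟨a, L, rfl⟩ := List.exists_cons_of_ne_nil hl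
    simp
  · obtain ⟨P, hP, he⟩ := List.mem_map.1 h
    exact ⟨P, hP, he.symm⟩

/-- Characterisation of `lo2` by bounds. [folklore] -/
theorem lo2_eq_of {m : ℤ} (h1 : ∀ P ∈ l, m ≤ P.2) (h2 : ∃ P ∈ l, P.2 = m) : lo2 l = m := by
  obtain ⟨P, hP, hPm⟩ := h2
  apply le_antisymm
  · rw [← hPm]; exact lo2_le hP
  · obtain ⟨Q, hQ, hQe⟩ := lo2_mem (List.ne_nil_of_mem hP)
    rw [hQe]; exact h1 Q hQ

/-- `lo2` is invariant under rotation. [folklore] -/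
theorem lo2_rotate (l : List Pt) (k : ℕ) : lo2 (l.rotate k) = lo2 l := by
  rcases eq_or_ne l [] with rfl | hl
  · simp
  apply lo2_eq_of
  · intro P hP; exact lo2_le (List.mem_rotate.1 hP)
  · obtain ⟨P, hP, he⟩ := lo2_mem hl
    exact ⟨P, List.mem_rotate.2 hP, he.symm⟩

/-- `lo2` is invariant under reflection. [folklore] -/
theorem lo2_map_refl (l : List Pt) : lo2 (l.map refl) = lo2 l := by
  simp [lo2, Function.comp_def, refl]

/-- **The potential**: the total height of the vertices above the lowest one. [folklore] -/
def Φ (l : List Pt) : ℕ := (l.map fun P => (P.2 - lo2 l).toNat).sum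

/-- The potential is invariant under rotation. [folklore] -/
theorem Φ_rotate (l : List Pt) (k : ℕ) : Φ (l.rotate k) = Φ l := by
  unfold Φ
  rw [lo2_rotate]
  exact ((List.rotate_perm l k).map _).sum_eq

/-- The potential is invariant under reflection. [folklore] -/
theorem Φ_map_refl (l : List Pt) : Φ (l.map refl) = Φ l := by
  unfold Φ
  rw [lo2_map_refl, List.map_map]
  rfl

end Potential

/-! ### The bump step: reflecting a top bump of a simple closed trail downwards -/

section Bump

variable {l : List Pt}

/-- Consecutive entries form a cyclic dart. [folklore] -/
theorem mem_cdarts_getElem (i : ℕ) (h : i + 1 < l.length) : (l[i], l[i + 1]) ∈ cdarts l := by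
  refine mem_cdarts_iff.2 ⟨i, by omega, ?_⟩
  simp only [Prod.mk.injEq, true_and]
  congr 1
  exact (Nat.mod_eq_of_lt h).symm

/-- The darts of a cycle whose first four vertices are singled out. [folklore] -/
theorem cdarts_four_append (a b c d : Pt) (M : List Pt) (hM : M ≠ []) :
    cdarts (a :: b :: c :: d :: M) = [(a, b), (b, c), (c, d)] ++ ((d, M.head hM) :: pdarts M ++ [(M.getLast hM, a)]) := by
  have := cdarts_append [a, b, c, d] M (by simp) hM
  simpa using this

/-- Splitting a list at a path dart. [folklore] -/
theorem exists_split_of_mem_pdarts {M : List Pt} {a b : Pt} (h : (a, b) ∈ pdarts M) :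
    ∃ M₁ M₂, M = M₁ ++ a :: b :: M₂ := by
  obtain ⟨i, hi, he⟩ := mem_pdarts_iff.1 h
  simp only [Prod.mk.injEq] at he
  refine ⟨M.take i, M.drop (i + 2), ?_⟩
  conv_lhs => rw [← List.take_append_drop i M]
  rw [List.drop_eq_getElem_cons (by omega : i < M.length), List.drop_eq_getElem_cons (by omega : i + 1 < M.length),
    he.1, he.2]

/-- **The reflected bump is a trail.** [folklore] -/
theorem bump_move_trail {zx zy : ℤ} {M : List Pt} (hz : (zx + zy) % 2 = 1) (hM : M ≠ [])
    (hl : IsTrail ((zx, zy - 1) :: (zx, zy) :: (zx + 1, zy) :: (zx + 1, zy - 1) :: M))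
    (hnd : ((zx, zy - 1) :: (zx, zy) :: (zx + 1, zy) :: (zx + 1, zy - 1) :: M).Nodup)
    (hq : ((zx, zy - 2), (zx + 1, zy - 2)) ∉ cdarts ((zx, zy - 1) :: (zx, zy) :: (zx + 1, zy) :: (zx + 1, zy - 1) :: M)) :
    IsTrail ((zx, zy - 1) :: (zx, zy - 2) :: (zx + 1, zy - 2) :: (zx + 1, zy - 1) :: M) := by
  have hc1 := cdarts_four_append (zx, zy - 1) (zx, zy) (zx + 1, zy) (zx + 1, zy - 1) M hM
  have hc2 := cdarts_four_append (zx, zy - 1) (zx, zy - 2) (zx + 1, zy - 2) (zx + 1, zy - 1) M hM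
  set D := (((zx + 1, zy - 1) : Pt), M.head hM) :: pdarts M ++ [(M.getLast hM, ((zx, zy - 1) : Pt))] with hD
  have hDsub : ∀ d ∈ D, d ∈ cdarts ((zx, zy - 1) :: (zx, zy) :: (zx + 1, zy) :: (zx + 1, zy - 1) :: M) := by
    intro d hd; rw [hc1]; exact List.mem_append_right _ hd
  have hDnd : D.Nodup := by
    have := hl.2.1; rw [hc1] at this; exact (List.nodup_append.1 this).2.1
  refine ⟨List.cons_ne_nil _ _, ?_, ?_⟩
  · rw [hc2, List.nodup_append]
    refine ⟨?_, hDnd, ?_⟩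
    · have n12 : ((((zx, zy - 1) : Pt), ((zx, zy - 2) : Pt)) : Pt × Pt) ≠ ((zx, zy - 2), (zx + 1, zy - 2)) :=
        ne_of_apply_ne (fun d : Pt × Pt => d.1.2) (by simp only; omega)
      have n13 : ((((zx, zy - 1) : Pt), ((zx, zy - 2) : Pt)) : Pt × Pt) ≠ ((zx + 1, zy - 2), (zx + 1, zy - 1)) :=
        ne_of_apply_ne (fun d : Pt × Pt => d.1.1) (by simp only; omega)
      have n23 : ((((zx, zy - 2) : Pt), ((zx + 1, zy - 2) : Pt)) : Pt × Pt) ≠ ((zx + 1, zy - 2), (zx + 1, zy - 1)) :=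
        ne_of_apply_ne (fun d : Pt × Pt => d.1.1) (by simp only; omega)
      simp [n12, n13, n23]
    · intro d hd d' hd' hdd'
      subst hdd'
      simp only [List.mem_cons, List.not_mem_nil, or_false] at hd
      have hd'' := hDsub d hd'
      rcases hd with rfl | rfl | rfl
      · -- `(p₁, q)`: the successor of `p₁` is `z`
        have hz1 : (((zx, zy - 1) : Pt), ((zx, zy) : Pt)) ∈
            cdarts ((zx, zy - 1) :: (zx, zy) :: (zx + 1, zy) :: (zx + 1, zy - 1) :: M) := by
          rw [hc1]; simp
        have := cdarts_succ_unique hnd hz1 hd''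
        simp only [Prod.mk.injEq] at this; omega
      · exact hq hd''
      · -- `(q', p₂)`: the predecessor of `p₂` is `z'`
        have hz2 : (((zx + 1, zy) : Pt), ((zx + 1, zy - 1) : Pt)) ∈
            cdarts ((zx, zy - 1) :: (zx, zy) :: (zx + 1, zy) :: (zx + 1, zy - 1) :: M) := by
          rw [hc1]; simp
        have := cdarts_pred_unique hnd hz2 hd''
        simp only [Prod.mk.injEq] at this; omega
  · rw [hc2]
    intro d hd
    rcases List.mem_append.1 hd with hd | hd
    · simp only [List.mem_cons, List.not_mem_nil, or_false] at hd
      rcases hd with rfl | rfl | rfl <;>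
        simp only [IsDart, true_and, and_true, true_or] <;> omega
    · exact hl.2.2 d (hDsub d hd)

/-- `dwnd` of three darts followed by a list. [folklore] -/
theorem dwnd_three (d₁ d₂ d₃ : Pt × Pt) (D : List (Pt × Pt)) (F : Pt) :
    dwnd ([d₁, d₂, d₃] ++ D) F = dartWnd d₁ F + dartWnd d₂ F + dartWnd d₃ F + dwnd D F := by
  simp only [dwnd_append, dwnd_cons, dwnd_nil]; ring

/-- The winding numbers of the bump and of the reflected bump differ by the two unit squares
between them. [folklore] -/
theorem bump_move_wnd {zx zy : ℤ} {M : List Pt} (hM : M ≠ []) (x y : ℤ) :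
    wnd ((zx, zy - 1) :: (zx, zy) :: (zx + 1, zy) :: (zx + 1, zy - 1) :: M) (x, y) =
      wnd ((zx, zy - 1) :: (zx, zy - 2) :: (zx + 1, zy - 2) :: (zx + 1, zy - 1) :: M) (x, y) -
        (if x = zx ∧ y = zy - 1 then 1 else 0) - (if x = zx ∧ y = zy - 2 then 1 else 0) := by
  rw [wnd, wnd, cdarts_four_append _ _ _ _ M hM, cdarts_four_append _ _ _ _ M hM, dwnd_three, dwnd_three]
  have v1 : dartWnd ((((zx, zy - 1) : Pt), ((zx, zy) : Pt)) : Pt × Pt) (x, y) =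
      -(if zx ≤ x ∧ y = zy - 1 then 1 else 0) := by
    simp only [dartWnd, sub_add_cancel, true_and]
    split_ifs <;> omega
  have v2 : dartWnd ((((zx, zy) : Pt), ((zx + 1, zy) : Pt)) : Pt × Pt) (x, y) = 0 := by
    simp only [dartWnd]
    split_ifs <;> omega
  have v3 : dartWnd ((((zx + 1, zy) : Pt), ((zx + 1, zy - 1) : Pt)) : Pt × Pt) (x, y) =
      (if zx + 1 ≤ x ∧ y = zy - 1 then 1 else 0) := by
    simp only [dartWnd, true_and]
    split_ifs <;> omega
  have v4 : dartWnd ((((zx, zy - 1) : Pt), ((zx, zy - 2) : Pt)) : Pt × Pt) (x, y) =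
      (if zx ≤ x ∧ y = zy - 2 then 1 else 0) := by
    simp only [dartWnd, sub_add_cancel, true_and]
    split_ifs <;> omega
  have v5 : dartWnd ((((zx, zy - 2) : Pt), ((zx + 1, zy - 2) : Pt)) : Pt × Pt) (x, y) = 0 := by
    simp only [dartWnd]
    split_ifs <;> omega
  have v6 : dartWnd ((((zx + 1, zy - 2) : Pt), ((zx + 1, zy - 1) : Pt)) : Pt × Pt) (x, y) =
      -(if zx + 1 ≤ x ∧ y = zy - 2 then 1 else 0) := by
    simp only [dartWnd, true_and]
    split_ifs <;> omega
  rw [v1, v2, v3, v4, v5, v6]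
  split_ifs <;> omega

/-- The turning numbers of the bump and of the reflected bump agree. [folklore] -/
theorem bump_move_cturn {zx zy : ℤ} {M : List Pt} (hM : M ≠ [])
    (hhead : M.head hM = (zx + 2, zy - 1)) (hlast : M.getLast hM = (zx - 1, zy - 1)) :
    cturn ((zx, zy - 1) :: (zx, zy) :: (zx + 1, zy) :: (zx + 1, zy - 1) :: M) =
      cturn ((zx, zy - 1) :: (zx, zy - 2) :: (zx + 1, zy - 2) :: (zx + 1, zy - 1) :: M) := by
  have e1 := cturn_split [(zx, zy - 1), (zx, zy), (zx + 1, zy), (zx + 1, zy - 1)] M (by simp) hM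
  have e2 := cturn_split [(zx, zy - 1), (zx, zy - 2), (zx + 1, zy - 2), (zx + 1, zy - 1)] M (by simp) hM
  simp only [List.cons_append, List.nil_append, List.getLast_cons_cons, List.getLast_singleton,
    List.head_cons] at e1 e2
  rw [hhead, hlast] at e1 e2
  have t1 : pturn [(zx - 1, zy - 1), (zx, zy - 1), (zx, zy), (zx + 1, zy), (zx + 1, zy - 1), (zx + 2, zy - 1)] = 0 := by
    simp only [pturn_cons₃, pturn_two, add_zero, turn]
    split_ifs <;> omega
  have t2 : pturn [(zx - 1, zy - 1), (zx, zy - 1), (zx, zy - 2), (zx + 1, zy - 2), (zx + 1, zy - 1), (zx + 2, zy - 1)] = 0 := by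
    simp only [pturn_cons₃, pturn_two, add_zero, turn]
    split_ifs <;> omega
  rw [e1, e2, t1, t2]

/-- The potential drops by four under the bump move. [folklore] -/
theorem bump_move_Φ {zx zy : ℤ} {M : List Pt}
    (hlo : lo2 ((zx, zy - 1) :: (zx, zy) :: (zx + 1, zy) :: (zx + 1, zy - 1) :: M) ≤ zy - 2) :
    Φ ((zx, zy - 1) :: (zx, zy - 2) :: (zx + 1, zy - 2) :: (zx + 1, zy - 1) :: M) + 4 =
      Φ ((zx, zy - 1) :: (zx, zy) :: (zx + 1, zy) :: (zx + 1, zy - 1) :: M) := by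
  set m := lo2 ((zx, zy - 1) :: (zx, zy) :: (zx + 1, zy) :: (zx + 1, zy - 1) :: M) with hm
  have hm1 : ∀ P ∈ ((zx, zy - 1) :: (zx, zy) :: (zx + 1, zy) :: (zx + 1, zy - 1) :: M), m ≤ P.2 :=
    fun P hP => lo2_le hP
  have hm2 : lo2 ((zx, zy - 1) :: (zx, zy - 2) :: (zx + 1, zy - 2) :: (zx + 1, zy - 1) :: M) = m := by
    apply lo2_eq_of
    · intro P hP
      simp only [List.mem_cons] at hP
      rcases hP with rfl | rfl | rfl | rfl | hP
      · exact hm1 _ (by simp)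
      · simp only; omega
      · simp only; omega
      · exact hm1 _ (by simp)
      · exact hm1 _ (by simp [hP])
    · obtain ⟨P, hP, he⟩ := lo2_mem (l := (zx, zy - 1) :: (zx, zy) :: (zx + 1, zy) :: (zx + 1, zy - 1) :: M)
        (List.cons_ne_nil _ _)
      rw [← hm] at he
      simp only [List.mem_cons] at hP
      rcases hP with rfl | rfl | rfl | rfl | hP
      · exact ⟨_, by simp, he.symm⟩
      · exfalso; simp only at he; omega
      · exfalso; simp only at he; omega
      · exact ⟨(zx + 1, zy - 1), by simp, he.symm⟩
      · exact ⟨P, by simp [hP], he.symm⟩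
  have hMm : ∀ P ∈ M, m ≤ P.2 := fun P hP => hm1 P (by simp [hP])
  unfold Φ
  rw [hm2, ← hm]
  simp only [List.map_cons, List.sum_cons]
  have h1 := hm1 (zx, zy - 1) (by simp)
  simp only at h1
  omega

/-- From the invariant of the reflected bump to the invariant of the bump: the original trail is
of negative type (the face under its top edge has winding number `-1`). [folklore] -/
theorem bump_move_inv {zx zy : ℤ} {M : List Pt} (hz : (zx + zy) % 2 = 1) (hM : M ≠ [])
    (hl : IsTrail ((zx, zy - 1) :: (zx, zy) :: (zx + 1, zy) :: (zx + 1, zy - 1) :: M))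
    (hnd : ((zx, zy - 1) :: (zx, zy) :: (zx + 1, zy) :: (zx + 1, zy - 1) :: M).Nodup)
    (htop : ∀ P ∈ ((zx, zy - 1) :: (zx, zy) :: (zx + 1, zy) :: (zx + 1, zy - 1) :: M), P.2 ≤ zy)
    (hhead : M.head hM = (zx + 2, zy - 1)) (hlast : M.getLast hM = (zx - 1, zy - 1))
    (hI : INV ((zx, zy - 1) :: (zx, zy - 2) :: (zx + 1, zy - 2) :: (zx + 1, zy - 1) :: M)) :
    INV ((zx, zy - 1) :: (zx, zy) :: (zx + 1, zy) :: (zx + 1, zy - 1) :: M) := by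
  have hc1 := cdarts_four_append (zx, zy - 1) (zx, zy) (zx + 1, zy) (zx + 1, zy - 1) M hM
  -- winding numbers of the original trail near the bump
  have w0 : wnd ((zx, zy - 1) :: (zx, zy) :: (zx + 1, zy) :: (zx + 1, zy - 1) :: M) (zx, zy) = 0 :=
    wnd_eq_zero_of_le (fun P hP => htop P hP)
  have hzz : (((zx, zy) : Pt), ((zx + 1, zy) : Pt)) ∈ cdarts ((zx, zy - 1) :: (zx, zy) :: (zx + 1, zy) :: (zx + 1, zy - 1) :: M) := by
    rw [hc1]; simp
  have hpz : (((zx, zy - 1) : Pt), ((zx, zy) : Pt)) ∈ cdarts ((zx, zy - 1) :: (zx, zy) :: (zx + 1, zy) :: (zx + 1, zy - 1) :: M) := by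
    rw [hc1]; simp
  have hlastd : ((M.getLast hM), ((zx, zy - 1) : Pt)) ∈ cdarts ((zx, zy - 1) :: (zx, zy) :: (zx + 1, zy) :: (zx + 1, zy - 1) :: M) := by
    rw [hc1]; simp
  rw [hlast] at hlastd
  have w1 := hl.wnd_lf hzz
  rw [show lf (((zx, zy) : Pt), ((zx + 1, zy) : Pt)) = (zx, zy) from lf_east _ _,
    show rf (((zx, zy) : Pt), ((zx + 1, zy) : Pt)) = (zx, zy - 1) from rf_east _ _] at w1
  have w2 := hl.wnd_lf hpz
  rw [show lf (((zx, zy - 1) : Pt), ((zx, zy) : Pt)) = (zx - 1, zy - 1) by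
      have := lf_north zx (zy - 1); rwa [sub_add_cancel] at this,
    show rf (((zx, zy - 1) : Pt), ((zx, zy) : Pt)) = (zx, zy - 1) by
      have := rf_north zx (zy - 1); rwa [sub_add_cancel] at this] at w2
  have w3 := hl.wnd_lf hlastd
  rw [show lf (((zx - 1, zy - 1) : Pt), ((zx, zy - 1) : Pt)) = (zx - 1, zy - 1) by
      have := lf_east (zx - 1) (zy - 1); rwa [sub_add_cancel] at this,
    show rf (((zx - 1, zy - 1) : Pt), ((zx, zy - 1) : Pt)) = (zx - 1, zy - 1 - 1) by
      have := rf_east (zx - 1) (zy - 1); rwa [sub_add_cancel] at this] at w3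
  -- the face under `[p₁, p₂]`: no dart of the trail on that segment
  have hpp : (((zx + 1, zy - 1) : Pt), ((zx, zy - 1) : Pt)) ∉ cdarts ((zx, zy - 1) :: (zx, zy) :: (zx + 1, zy) :: (zx + 1, zy - 1) :: M) := by
    intro h
    have h' : (((zx + 1, zy - 1) : Pt), M.head hM) ∈ cdarts ((zx, zy - 1) :: (zx, zy) :: (zx + 1, zy) :: (zx + 1, zy - 1) :: M) := by
      rw [hc1]; simp
    have := cdarts_succ_unique hnd h' h
    rw [hhead] at this
    simp only [Prod.mk.injEq] at this; omega
  have w4 := wnd_lf_eq_rf hl.2.2 (d := (((zx + 1, zy - 1) : Pt), ((zx, zy - 1) : Pt)))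
    (by simp only [IsDart, true_and]; omega) hpp
  rw [show lf (((zx + 1, zy - 1) : Pt), ((zx, zy - 1) : Pt)) = (zx, zy - 1 - 1) by
      have := lf_west (zx + 1) (zy - 1); rwa [add_sub_cancel_right] at this,
    show rf (((zx + 1, zy - 1) : Pt), ((zx, zy - 1) : Pt)) = (zx, zy - 1) by
      have := rf_west (zx + 1) (zy - 1); rwa [add_sub_cancel_right] at this] at w4
  have hw := fun x y => bump_move_wnd (zx := zx) (zy := zy) hM x y
  have hct := bump_move_cturn hM hhead hlast
  rcases hI with ⟨hc, hv⟩ | ⟨hc, hv⟩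
  · exfalso
    have h1 := hv (zx - 1, zy - 1 - 1)
    have h2 := hw (zx - 1) (zy - 1 - 1)
    rw [if_neg (by omega), if_neg (by omega)] at h2
    omega
  · right
    refine ⟨by omega, fun F => ?_⟩
    obtain ⟨x, y⟩ := F
    have h1 := hv (x, y)
    have h2 := hw x y
    by_cases hx : x = zx ∧ y = zy - 1
    · obtain ⟨rfl, rfl⟩ := hx; omega
    · rw [if_neg hx] at h2
      by_cases hx' : x = zx ∧ y = zy - 2
      · obtain ⟨rfl, rfl⟩ := hx'
        rw [show zy - 1 - 1 = zy - 2 by ring] at w4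
        omega
      · rw [if_neg hx'] at h2; omega

end Bump

/-! ### No trail passes directly under its own top bump -/

section Conflict

/-- **The trail does not run eastwards directly under its top bump.** If a vertex-simple closed
trail has the top bump `p₁ → z → z' → p₂` (north, east, south) and also the dart `q → q'` one
unit below `p₁ p₂`, then rerouting produces two closed trails `C₁ = p₁ q q' …` and
`C₂ = p₂ … q q'` sharing the dart `q → q'`, each lying in the region where the other's winding
number vanishes (tube lemma from the top), while the face under `q q'` has winding number `-1`
for both — contradicting the two-trails lemma. [folklore] -/
theorem bump_conflict {zx zy : ℤ} {M M₁ M₂ : List Pt} (hz : (zx + zy) % 2 = 1) (hM₁ : M₁ ≠ []) (hM₂ : M₂ ≠ [])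
    (hMeq : M = M₁ ++ (zx, zy - 2) :: (zx + 1, zy - 2) :: M₂)
    (hl : IsTrail ((zx, zy - 1) :: (zx, zy) :: (zx + 1, zy) :: (zx + 1, zy - 1) :: M))
    (hnd : ((zx, zy - 1) :: (zx, zy) :: (zx + 1, zy) :: (zx + 1, zy - 1) :: M).Nodup)
    (htop : ∀ P ∈ ((zx, zy - 1) :: (zx, zy) :: (zx + 1, zy) :: (zx + 1, zy - 1) :: M), P.2 ≤ zy) : False := by
  have hM : M ≠ [] := by rw [hMeq]; simp [hM₁]
  -- vertex facts from `Nodup`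
  have hn := hnd
  simp only [List.nodup_cons, List.mem_cons, not_or] at hn
  obtain ⟨⟨-, -, -, hp₁M⟩, ⟨-, -, hzM⟩, ⟨-, hz'M⟩, hp₂M, -⟩ := hn
  have hqM : ((zx, zy - 2) : Pt) ∈ M := by rw [hMeq]; simp
  have hq'M : ((zx + 1, zy - 2) : Pt) ∈ M := by rw [hMeq]; simp
  have hM₁M : ∀ P ∈ M₁, P ∈ M := fun P hP => by rw [hMeq]; exact List.mem_append_left _ hP
  have hM₂M : ∀ P ∈ M₂, P ∈ M := fun P hP => by rw [hMeq]; simp [hP]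
  -- the dart decomposition `cdarts L = P_A ++ X₂ ++ T₁`
  have hc := cdarts_four_append (zx, zy - 1) (zx, zy) (zx + 1, zy) (zx + 1, zy - 1) M hM
  have hMh : M.head hM = M₁.head hM₁ := by simp only [hMeq, List.head_append_of_ne_nil hM₁]
  have hMl : M.getLast hM = M₂.getLast hM₂ := by
    simp only [hMeq, List.getLast_append_of_ne_nil _ (List.cons_ne_nil _ _), List.getLast_cons_cons,
      List.getLast_cons hM₂]
  set X₂ : List (Pt × Pt) := pdarts ((zx + 1, zy - 1) :: M₁) ++ [(M₁.getLast hM₁, ((zx, zy - 2) : Pt))] with hX₂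
  set T₁' : List (Pt × Pt) := pdarts (((zx + 1, zy - 2) : Pt) :: M₂) ++ [(M₂.getLast hM₂, ((zx, zy - 1) : Pt))] with hT₁'
  have hdec : cdarts ((zx, zy - 1) :: (zx, zy) :: (zx + 1, zy) :: (zx + 1, zy - 1) :: M) =
      [(((zx, zy - 1) : Pt), ((zx, zy) : Pt)), ((zx, zy), (zx + 1, zy)), ((zx + 1, zy), (zx + 1, zy - 1))] ++ X₂ ++
        ((((zx, zy - 2) : Pt), ((zx + 1, zy - 2) : Pt)) :: T₁') := by
    rw [hc, hMh, hMl, hX₂, hT₁', pdarts_cons_of_ne_nil _ hM₁]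
    conv_lhs => rw [hMeq, pdarts_append_cons_cons, pdarts_append_singleton _ hM₁, pdarts_cons_cons]
    simp
  -- the two new cycles
  set C₁ : List Pt := (zx, zy - 1) :: (zx, zy - 2) :: (zx + 1, zy - 2) :: M₂ with hC₁
  set C₂ : List Pt := ((zx + 1, zy - 1) :: M₁) ++ [(zx, zy - 2), (zx + 1, zy - 2)] with hC₂
  have hcC₁ : cdarts C₁ = (((zx, zy - 1) : Pt), ((zx, zy - 2) : Pt)) :: (((zx, zy - 2) : Pt), ((zx + 1, zy - 2) : Pt)) :: T₁' := by
    have := cdarts_append [((zx, zy - 1) : Pt), (zx, zy - 2)] (((zx + 1, zy - 2) : Pt) :: M₂) (by simp) (by simp)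
    rw [hC₁, hT₁']
    rw [show ((zx, zy - 1) : Pt) :: ((zx, zy - 2) : Pt) :: ((zx + 1, zy - 2) : Pt) :: M₂ =
      [((zx, zy - 1) : Pt), (zx, zy - 2)] ++ (((zx + 1, zy - 2) : Pt) :: M₂) from rfl, this, List.getLast_cons hM₂]
    simp
  have hcC₂ : cdarts C₂ = X₂ ++ [(((zx, zy - 2) : Pt), ((zx + 1, zy - 2) : Pt)), ((zx + 1, zy - 2), (zx + 1, zy - 1))] := by
    have := cdarts_append (((zx + 1, zy - 1) : Pt) :: M₁) [((zx, zy - 2) : Pt), (zx + 1, zy - 2)] (by simp) (by simp)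
    rw [hC₂, hX₂, this, List.getLast_cons hM₁]
    simp
  -- nodup consequences
  have hN := hl.2.1
  rw [hdec, List.append_assoc, List.nodup_append] at hN
  obtain ⟨-, hN2, hPA⟩ := hN
  rw [List.nodup_append] at hN2
  obtain ⟨hX, hT, hXT⟩ := hN2
  have hT' := hT
  rw [List.nodup_cons] at hT'
  obtain ⟨hqqT, hT''⟩ := hT'
  -- memberships in `cdarts L`
  have memL : ∀ d, d ∈ cdarts ((zx, zy - 1) :: (zx, zy) :: (zx + 1, zy) :: (zx + 1, zy - 1) :: M) ↔
      d ∈ [(((zx, zy - 1) : Pt), ((zx, zy) : Pt)), ((zx, zy), (zx + 1, zy)), ((zx + 1, zy), (zx + 1, zy - 1))] ∨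
        d ∈ X₂ ∨ (d = (((zx, zy - 2) : Pt), ((zx + 1, zy - 2) : Pt)) ∨ d ∈ T₁') := by
    intro d; rw [hdec]; simp only [List.mem_append, List.mem_cons, or_assoc]
  have hX₂L : ∀ d ∈ X₂, d ∈ cdarts ((zx, zy - 1) :: (zx, zy) :: (zx + 1, zy) :: (zx + 1, zy - 1) :: M) :=
    fun d hd => (memL d).2 (Or.inr (Or.inl hd))
  have hT₁L : ∀ d ∈ T₁', d ∈ cdarts ((zx, zy - 1) :: (zx, zy) :: (zx + 1, zy) :: (zx + 1, zy - 1) :: M) :=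
    fun d hd => (memL d).2 (Or.inr (Or.inr (Or.inr hd)))
  have hqqL : (((zx, zy - 2) : Pt), ((zx + 1, zy - 2) : Pt)) ∈ cdarts ((zx, zy - 1) :: (zx, zy) :: (zx + 1, zy) :: (zx + 1, zy - 1) :: M) :=
    (memL _).2 (Or.inr (Or.inr (Or.inl rfl)))
  have hpzL : (((zx, zy - 1) : Pt), ((zx, zy) : Pt)) ∈ cdarts ((zx, zy - 1) :: (zx, zy) :: (zx + 1, zy) :: (zx + 1, zy - 1) :: M) :=
    (memL _).2 (Or.inl (by simp))
  have hz'pL : (((zx + 1, zy) : Pt), ((zx + 1, zy - 1) : Pt)) ∈ cdarts ((zx, zy - 1) :: (zx, zy) :: (zx + 1, zy) :: (zx + 1, zy - 1) :: M) :=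
    (memL _).2 (Or.inl (by simp))
  -- the two new darts are not darts of `L`
  have hnew₁ : (((zx, zy - 1) : Pt), ((zx, zy - 2) : Pt)) ∉ cdarts ((zx, zy - 1) :: (zx, zy) :: (zx + 1, zy) :: (zx + 1, zy - 1) :: M) := by
    intro h; have := cdarts_succ_unique hnd hpzL h; simp only [Prod.mk.injEq] at this; omega
  have hnew₂ : (((zx + 1, zy - 2) : Pt), ((zx + 1, zy - 1) : Pt)) ∉ cdarts ((zx, zy - 1) :: (zx, zy) :: (zx + 1, zy) :: (zx + 1, zy - 1) :: M) := by
    intro h; have := cdarts_pred_unique hnd hz'pL h; simp only [Prod.mk.injEq] at this; omega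
  -- the two new cycles are trails
  have hC₁t : IsTrail C₁ := by
    refine ⟨by simp [hC₁], ?_, ?_⟩
    · rw [hcC₁, List.nodup_cons]
      refine ⟨?_, hT⟩
      intro h
      rw [List.mem_cons] at h
      rcases h with h | h
      · simp only [Prod.mk.injEq] at h; omega
      · exact hnew₁ (hT₁L _ h)
    · rw [hcC₁]
      intro d hd
      rw [List.mem_cons] at hd
      rcases hd with rfl | hd
      · simp only [IsDart, true_and]; omega
      · exact hl.2.2 d ((memL d).2 (Or.inr (Or.inr (List.mem_cons.1 hd))))
  have hC₂t : IsTrail C₂ := by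
    refine ⟨by simp [hC₂], ?_, ?_⟩
    · rw [hcC₂, List.nodup_append]
      refine ⟨hX, ?_, ?_⟩
      · have : ((((zx, zy - 2) : Pt), ((zx + 1, zy - 2) : Pt)) : Pt × Pt) ≠ ((zx + 1, zy - 2), (zx + 1, zy - 1)) :=
          ne_of_apply_ne (fun d : Pt × Pt => d.1.1) (by simp only; omega)
        simp [this]
      · intro a ha b hb hab
        subst hab
        simp only [List.mem_cons, List.not_mem_nil, or_false] at hb
        rcases hb with rfl | rfl
        · exact hXT _ ha _ (List.mem_cons_self) rfl
        · exact hnew₂ (hX₂L _ ha)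
    · rw [hcC₂]
      intro d hd
      rcases List.mem_append.1 hd with hd | hd
      · exact hl.2.2 d (hX₂L d hd)
      · simp only [List.mem_cons, List.not_mem_nil, or_false] at hd
        rcases hd with rfl | rfl
        · exact hl.2.2 _ hqqL
        · simp only [IsDart, true_and]; omega
  -- tube along `C₁ ∖ qq'` inside `C₂`
  have hW₁ : pdarts ((((zx + 1, zy - 2) : Pt) :: M₂) ++ [((zx, zy - 1) : Pt), (zx, zy - 2)]) =
      T₁' ++ [(((zx, zy - 1) : Pt), ((zx, zy - 2) : Pt))] := by
    rw [pdarts_append_cons_cons, pdarts_append_singleton _ (List.cons_ne_nil _ _), List.getLast_cons hM₂, hT₁']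
    simp
  obtain ⟨β₀, hβ₀⟩ := tube_chain hC₂t.2.2 ((((zx + 1, zy - 2) : Pt) :: M₂) ++ [((zx, zy - 1) : Pt), (zx, zy - 2)])
    (by simp) (by
      rw [hW₁]; intro d hd
      rcases List.mem_append.1 hd with hd | hd
      · exact hl.2.2 d (hT₁L d hd)
      · simp only [List.mem_singleton] at hd; subst hd
        simp only [IsDart, true_and]; omega)
    (by
      rw [hW₁, hcC₂]; intro d hd hd2
      rcases List.mem_append.1 hd with hd | hd
      · rcases List.mem_append.1 hd2 with hd2 | hd2
        · exact hXT d hd2 d (List.mem_cons_of_mem _ hd) rfl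
        · simp only [List.mem_cons, List.not_mem_nil, or_false] at hd2
          rcases hd2 with rfl | rfl
          · exact hqqT hd
          · exact hnew₂ (hT₁L _ hd)
      · simp only [List.mem_singleton] at hd; subst hd
        rcases List.mem_append.1 hd2 with hd2 | hd2
        · exact hnew₁ (hX₂L _ hd2)
        · simp only [List.mem_cons, List.not_mem_nil, or_false, Prod.mk.injEq] at hd2; omega)
  -- tube along `C₂ ∖ qq'` inside `C₁`
  have hW₂ : pdarts (((zx + 1, zy - 2) : Pt) :: ((((zx + 1, zy - 1) : Pt) :: M₁) ++ [((zx, zy - 2) : Pt)])) =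
      (((zx + 1, zy - 2) : Pt), ((zx + 1, zy - 1) : Pt)) :: X₂ := by
    show ((((zx + 1, zy - 2) : Pt), ((zx + 1, zy - 1) : Pt)) : Pt × Pt) ::
        pdarts ((((zx + 1, zy - 1) : Pt) :: M₁) ++ [((zx, zy - 2) : Pt)]) = _
    rw [pdarts_append_singleton _ (List.cons_ne_nil _ _), List.getLast_cons hM₁, hX₂]
  obtain ⟨α₀, hα₀⟩ := tube_chain hC₁t.2.2 (((zx + 1, zy - 2) : Pt) :: ((((zx + 1, zy - 1) : Pt) :: M₁) ++ [((zx, zy - 2) : Pt)]))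
    (by simp) (by
      rw [hW₂]; intro d hd
      rw [List.mem_cons] at hd
      rcases hd with rfl | hd
      · simp only [IsDart, true_and]; omega
      · exact hl.2.2 d (hX₂L d hd))
    (by
      rw [hW₂, hcC₁]; intro d hd hd1
      simp only [List.mem_cons (b := (((zx, zy - 1) : Pt), ((zx, zy - 2) : Pt)))] at hd1
      rw [List.mem_cons] at hd
      rcases hd with rfl | hd
      · rcases hd1 with h | h
        · simp only [Prod.mk.injEq] at h; omega
        · rw [List.mem_cons] at h
          rcases h with h | h
          · simp only [Prod.mk.injEq] at h; omega
          · exact hnew₂ (hT₁L _ h)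
      · rcases hd1 with h | h
        · exact hnew₁ (h ▸ hX₂L _ hd)
        · exact hXT d hd d h rfl)
  -- the constants vanish: look at the faces above
  have hC₂top : ∀ P ∈ C₂, P.2 ≤ zy := by
    intro P hP
    simp only [hC₂, List.cons_append, List.mem_cons, List.mem_append, List.not_mem_nil,
      or_false] at hP
    rcases hP with rfl | hP | rfl | rfl
    · simp only; omega
    · exact htop P (by simp [hM₁M P hP])
    · simp only; omega
    · simp only; omega
  have hC₁top : ∀ P ∈ C₁, P.2 ≤ zy := by
    intro P hP
    simp only [hC₁, List.mem_cons] at hP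
    rcases hP with rfl | rfl | rfl | hP
    · simp only; omega
    · simp only; omega
    · simp only; omega
    · exact htop P (by simp [hM₂M P hP])
  have hp₁C₂ : ((zx, zy - 1) : Pt) ∉ C₂ := by
    simp only [hC₂, List.cons_append, List.mem_cons, List.mem_append, List.not_mem_nil,
      or_false, Prod.mk.injEq, not_or]
    exact ⟨by omega, fun h => hp₁M (hM₁M _ h), by omega, by omega⟩
  have hzC₂ : ((zx, zy) : Pt) ∉ C₂ := by
    simp only [hC₂, List.cons_append, List.mem_cons, List.mem_append, List.not_mem_nil,
      or_false, Prod.mk.injEq, not_or]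
    exact ⟨by omega, fun h => hzM (hM₁M _ h), by omega, by omega⟩
  have hp₂C₁ : ((zx + 1, zy - 1) : Pt) ∉ C₁ := by
    simp only [hC₁, List.mem_cons, Prod.mk.injEq, not_or]
    exact ⟨by omega, by omega, by omega, fun h => hp₂M (hM₂M _ h)⟩
  have hzC₁ : ((zx, zy) : Pt) ∉ C₁ := by
    simp only [hC₁, List.mem_cons, Prod.mk.injEq, not_or]
    exact ⟨by omega, by omega, by omega, fun h => hzM (hM₂M _ h)⟩
  have dpp : IsDart ((zx + 1, zy - 1) : Pt) ((zx, zy - 1) : Pt) := by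
    simp only [IsDart, true_and]; omega
  have dzz : IsDart ((zx, zy) : Pt) ((zx + 1, zy) : Pt) := by
    simp only [IsDart, and_true, true_or]; omega
  have f1 : lf ((((zx + 1, zy - 1) : Pt), ((zx, zy - 1) : Pt)) : Pt × Pt) = (zx, zy - 2) := by
    simp only [lf]; (try split_ifs) <;> (try simp only [Prod.mk.injEq]) <;> omega
  have f2 : rf ((((zx + 1, zy - 1) : Pt), ((zx, zy - 1) : Pt)) : Pt × Pt) = (zx, zy - 1) := by
    simp only [rf]; (try split_ifs) <;> (try simp only [Prod.mk.injEq, and_true]) <;> omega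
  have f3 : lf ((((zx, zy) : Pt), ((zx + 1, zy) : Pt)) : Pt × Pt) = (zx, zy) := by
    simp only [lf, ↓reduceIte]; (try split_ifs) <;> (try simp only [Prod.mk.injEq, true_and, and_true]) <;> omega
  have f4 : rf ((((zx, zy) : Pt), ((zx + 1, zy) : Pt)) : Pt × Pt) = (zx, zy - 1) := by
    simp only [rf, ↓reduceIte]; (try split_ifs) <;> (try simp only [Prod.mk.injEq, true_and, and_true]) <;> omega
  have f5 : lf ((((zx, zy - 1) : Pt), ((zx, zy - 2) : Pt)) : Pt × Pt) = (zx, zy - 2) := by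
    simp only [lf]; (try split_ifs) <;> (try simp only [Prod.mk.injEq, true_and]) <;> omega
  have f6 : lf ((((zx + 1, zy - 2) : Pt), ((zx + 1, zy - 1) : Pt)) : Pt × Pt) = (zx, zy - 2) := by
    simp only [lf]; (try split_ifs) <;> (try simp only [Prod.mk.injEq, and_true]) <;> omega
  have f7 : lf ((((zx, zy - 2) : Pt), ((zx + 1, zy - 2) : Pt)) : Pt × Pt) = (zx, zy - 2) := by
    simp only [lf, ↓reduceIte]; (try split_ifs) <;> (try simp only [Prod.mk.injEq, true_and, and_true]) <;> omega
  have f8 : rf ((((zx, zy - 2) : Pt), ((zx + 1, zy - 2) : Pt)) : Pt × Pt) = (zx, zy - 3) := by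
    simp only [rf, ↓reduceIte]; (try split_ifs) <;> (try simp only [Prod.mk.injEq, true_and]) <;> omega
  have hβ : β₀ = 0 := by
    have e1 := (hβ₀ (((zx, zy - 1) : Pt), ((zx, zy - 2) : Pt)) (by rw [hW₁]; simp)).1
    rw [f5] at e1
    have e2 := wnd_lf_eq_rf hC₂t.2.2 (d := (((zx + 1, zy - 1) : Pt), ((zx, zy - 1) : Pt))) dpp
      (fun h => hp₁C₂ (mem_of_mem_cdarts h).2)
    rw [f1, f2] at e2
    have e3 := wnd_lf_eq_rf hC₂t.2.2 (d := (((zx, zy) : Pt), ((zx + 1, zy) : Pt))) dzz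
      (fun h => hzC₂ (mem_of_mem_cdarts h).1)
    rw [f3, f4] at e3
    have e4 : wnd C₂ (zx, zy) = 0 := wnd_eq_zero_of_le hC₂top
    omega
  have hα : α₀ = 0 := by
    have e1 := (hα₀ (((zx + 1, zy - 2) : Pt), ((zx + 1, zy - 1) : Pt)) (by rw [hW₂]; simp)).1
    rw [f6] at e1
    have e2 := wnd_lf_eq_rf hC₁t.2.2 (d := (((zx + 1, zy - 1) : Pt), ((zx, zy - 1) : Pt))) dpp
      (fun h => hp₂C₁ (mem_of_mem_cdarts h).1)
    rw [f1, f2] at e2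
    have e3 := wnd_lf_eq_rf hC₁t.2.2 (d := (((zx, zy) : Pt), ((zx + 1, zy) : Pt))) dzz
      (fun h => hzC₁ (mem_of_mem_cdarts h).1)
    rw [f3, f4] at e3
    have e4 : wnd C₁ (zx, zy) = 0 := wnd_eq_zero_of_le hC₁top
    omega
  -- the face under `q q'`
  have g1 := hC₁t.wnd_lf (d := (((zx, zy - 2) : Pt), ((zx + 1, zy - 2) : Pt))) (by rw [hcC₁]; simp)
  have g2 := hC₂t.wnd_lf (d := (((zx, zy - 2) : Pt), ((zx + 1, zy - 2) : Pt))) (by rw [hcC₂]; simp)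
  rw [f7, f8] at g1 g2
  -- two-trails lemma
  have h2 := two_trails hC₁t hC₂t (((zx, zy - 2) : Pt), ((zx + 1, zy - 2) : Pt)) α₀ β₀
    (by
      rw [hcC₂]; intro d hd hne
      apply hα₀ d
      rw [hW₂]
      rcases List.mem_append.1 hd with hd | hd
      · exact List.mem_cons_of_mem _ hd
      · simp only [List.mem_cons, List.not_mem_nil, or_false] at hd
        rcases hd with rfl | rfl
        · exact absurd rfl hne
        · exact List.mem_cons_self)
    (by
      rw [hcC₁]; intro d hd hne
      apply hβ₀ d
      rw [hW₁]
      rw [List.mem_cons, List.mem_cons] at hd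
      rcases hd with rfl | rfl | hd
      · simp
      · exact absurd rfl hne
      · exact List.mem_append_left _ hd)
  have := h2.2 (zx, zy - 3)
  have e0 : wnd C₁ (zx, zy - 2) = 0 := by
    have e2 := wnd_lf_eq_rf hC₁t.2.2 (d := (((zx + 1, zy - 1) : Pt), ((zx, zy - 1) : Pt))) dpp
      (fun h => hp₂C₁ (mem_of_mem_cdarts h).1)
    rw [f1, f2] at e2
    have e3 := wnd_lf_eq_rf hC₁t.2.2 (d := (((zx, zy) : Pt), ((zx + 1, zy) : Pt))) dzz
      (fun h => hzC₁ (mem_of_mem_cdarts h).1)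
    rw [f3, f4] at e3
    have e4 : wnd C₁ (zx, zy) = 0 := wnd_eq_zero_of_le hC₁top
    omega
  have e0' : wnd C₂ (zx, zy - 2) = 0 := by
    have e2 := wnd_lf_eq_rf hC₂t.2.2 (d := (((zx + 1, zy - 1) : Pt), ((zx, zy - 1) : Pt))) dpp
      (fun h => hp₁C₂ (mem_of_mem_cdarts h).2)
    rw [f1, f2] at e2
    have e3 := wnd_lf_eq_rf hC₂t.2.2 (d := (((zx, zy) : Pt), ((zx + 1, zy) : Pt))) dzz
      (fun h => hzC₂ (mem_of_mem_cdarts h).1)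
    rw [f3, f4] at e3
    have e4 : wnd C₂ (zx, zy) = 0 := wnd_eq_zero_of_le hC₂top
    omega
  omega

end Conflict

/-! ### The bump step and the main induction -/

section Main

variable {l : List Pt}

/-- **The bump step.** Let `l` be a vertex-simple closed trail of length `> 4`, `z → z'` an east
dart in its top row such that no east dart of the top row starts further east. Then `l` reads
`p₁ z z' p₂ M` after rotation with `p₁, p₂` below `z, z'`, the last vertex of `M` is west of
`p₁` and its first vertex `p₃` east of `p₂`, and the dart out of `p₃` goes down (so the trail
has a vertex two rows below the top). Either the dart `q → q'` under `p₁ p₂` is on the trail —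
impossible by `bump_conflict` — or reflecting the bump down gives a trail of the same length and
smaller potential, whose invariant (induction hypothesis) transfers back. [folklore] -/
theorem bump_step (hl : IsTrail l) (hnd : l.Nodup) (h4 : 4 < l.length)
    (hIH : ∀ l' : List Pt, l'.length = l.length → Φ l' + 4 ≤ Φ l → IsTrail l' → INV l')
    {z : Pt} (hz : (z, (z.1 + 1, z.2)) ∈ cdarts l) (htop : ∀ P ∈ l, P.2 ≤ z.2)
    (hmax : ∀ y : Pt, (y, (y.1 + 1, y.2)) ∈ cdarts l → y.2 = z.2 → y.1 ≤ z.1) : INV l := by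
  obtain ⟨zx, zy⟩ := z
  simp only at hz htop hmax
  have dz := hl.2.2 _ hz
  simp only at dz
  have hzodd : (zx + zy) % 2 = 1 := by
    simp only [IsDart, and_true, true_or] at dz; omega
  have hzl : ((zx, zy) : Pt) ∈ l := (mem_of_mem_cdarts hz).1
  have hz'l : ((zx + 1, zy) : Pt) ∈ l := (mem_of_mem_cdarts hz).2
  -- the predecessor of `z` is `p₁ = z - e₂`
  obtain ⟨p₁, hp₁⟩ := exists_cdarts_snd hzl
  have hp₁e : p₁ = (zx, zy - 1) := by
    have hd := hl.2.2 _ hp₁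
    have ht := htop _ (mem_of_mem_cdarts hp₁).1
    obtain ⟨a, b⟩ := p₁
    simp only at hd ht
    simp only [IsDart] at hd
    simp only [Prod.mk.injEq]
    omega
  subst hp₁e
  -- the successor of `z'` is `p₂ = z' - e₂`
  obtain ⟨p₂, hp₂⟩ := exists_cdarts_fst hz'l
  have hp₂e : p₂ = (zx + 1, zy - 1) := by
    have hd := hl.2.2 _ hp₂
    have ht := htop _ (mem_of_mem_cdarts hp₂).2
    obtain ⟨a, b⟩ := p₂
    simp only at hd ht
    simp only [IsDart] at hd
    simp only [Prod.mk.injEq]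
    omega
  subst hp₂e
  -- rotate so that the trail starts at `p₁`
  obtain ⟨k, M₀, -, hrot⟩ := exists_rotate_eq_cons_cons (by omega) hp₁
  have hl₁ : IsTrail (l.rotate k) := hl.rotate k
  have hnd₁ : (l.rotate k).Nodup := List.nodup_rotate.2 hnd
  have hmem : ∀ d, d ∈ cdarts (l.rotate k) ↔ d ∈ cdarts l := fun d => (cdarts_rotate_perm l k).mem_iff
  have hmemv : ∀ P, P ∈ l.rotate k ↔ P ∈ l := fun P => List.mem_rotate
  have hlen : (l.rotate k).length = l.length := List.length_rotate _ _
  have hΦ : Φ (l.rotate k) = Φ l := Φ_rotate l k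
  rw [← inv_rotate_iff (by omega) k]
  rw [hrot] at hl₁ hnd₁ hmem hmemv hlen hΦ ⊢
  -- the two vertices after `z` are `z'` and `p₂`
  obtain ⟨M, rfl⟩ : ∃ M, M₀ = ((zx + 1, zy) : Pt) :: ((zx + 1, zy - 1) : Pt) :: M := by
    have hs := (hmem _).2 hz
    rcases M₀ with _ | ⟨m, M₁⟩
    · exfalso
      have h2 : (((zx, zy) : Pt), ((zx, zy - 1) : Pt)) ∈ cdarts [((zx, zy - 1) : Pt), (zx, zy)] := by simp [cdarts]
      have := cdarts_succ_unique hnd₁ hs h2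
      simp only [Prod.mk.injEq] at this; omega
    · have hm : (((zx, zy) : Pt), m) ∈ cdarts (((zx, zy - 1) : Pt) :: (zx, zy) :: m :: M₁) :=
        mem_cdarts_getElem (l := ((zx, zy - 1) : Pt) :: (zx, zy) :: m :: M₁) 1 (by simp)
      have em := cdarts_succ_unique hnd₁ hs hm
      subst em
      rcases M₁ with _ | ⟨m', M⟩
      · exfalso
        have h2 : (((zx + 1, zy) : Pt), ((zx, zy - 1) : Pt)) ∈ cdarts [((zx, zy - 1) : Pt), (zx, zy), (zx + 1, zy)] := by
          simp [cdarts]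
        have := cdarts_succ_unique hnd₁ ((hmem _).2 hp₂) h2
        simp only [Prod.mk.injEq] at this; omega
      · have hm' : (((zx + 1, zy) : Pt), m') ∈ cdarts (((zx, zy - 1) : Pt) :: (zx, zy) :: (zx + 1, zy) :: m' :: M) :=
          mem_cdarts_getElem (l := ((zx, zy - 1) : Pt) :: (zx, zy) :: (zx + 1, zy) :: m' :: M) 2 (by simp)
        have em' := cdarts_succ_unique hnd₁ ((hmem _).2 hp₂) hm'
        subst em'
        exact ⟨M, rfl⟩
  have hM : M ≠ [] := by rintro rfl; simp at hlen; omega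
  -- vertex facts from `Nodup`
  have hn := hnd₁
  simp only [List.nodup_cons, List.mem_cons, not_or] at hn
  obtain ⟨⟨-, -, -, hp₁M⟩, ⟨-, -, hzM⟩, ⟨-, hz'M⟩, hp₂M, -⟩ := hn
  have hc := cdarts_four_append (zx, zy - 1) (zx, zy) (zx + 1, zy) (zx + 1, zy - 1) M hM
  -- the last vertex of `M` is `p₀ = p₁ - e₁`, its first vertex is `p₃ = p₂ + e₁`
  have hlast : M.getLast hM = (zx - 1, zy - 1) := by
    have hd : (M.getLast hM, ((zx, zy - 1) : Pt)) ∈ cdarts (((zx, zy - 1) : Pt) :: (zx, zy) :: (zx + 1, zy) :: (zx + 1, zy - 1) :: M) := by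
      rw [hc]; simp
    have hD := hl₁.2.2 _ hd
    have hne : M.getLast hM ≠ (zx + 1, zy - 1) := fun h => hp₂M (h ▸ List.getLast_mem hM)
    generalize M.getLast hM = g at hD hne ⊢
    obtain ⟨a, b⟩ := g
    simp only at hD
    simp only [IsDart] at hD
    simp only [ne_eq, Prod.mk.injEq, not_and] at hne
    simp only [Prod.mk.injEq]; omega
  have hhead : M.head hM = (zx + 2, zy - 1) := by
    have hd : (((zx + 1, zy - 1) : Pt), M.head hM) ∈ cdarts (((zx, zy - 1) : Pt) :: (zx, zy) :: (zx + 1, zy) :: (zx + 1, zy - 1) :: M) := by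
      rw [hc]; simp
    have hD := hl₁.2.2 _ hd
    have hne : M.head hM ≠ (zx, zy - 1) := fun h => hp₁M (h ▸ List.head_mem hM)
    generalize M.head hM = g at hD hne ⊢
    obtain ⟨a, b⟩ := g
    simp only at hD
    simp only [IsDart] at hD
    simp only [ne_eq, Prod.mk.injEq, not_and] at hne
    simp only [Prod.mk.injEq]; omega
  -- the dart out of `p₃` goes down: a vertex two rows below the top
  have hlow : ∃ P ∈ (((zx, zy - 1) : Pt) :: (zx, zy) :: (zx + 1, zy) :: (zx + 1, zy - 1) :: M), P.2 ≤ zy - 2 := by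
    have hp₃ : ((zx + 2, zy - 1) : Pt) ∈ (((zx, zy - 1) : Pt) :: (zx, zy) :: (zx + 1, zy) :: (zx + 1, zy - 1) :: M) := by
      rw [← hhead]; simp [List.head_mem]
    obtain ⟨p₄, h34⟩ := exists_cdarts_fst hp₃
    have hD := hl₁.2.2 _ h34
    simp only at hD
    by_cases hup : p₄ = (zx + 2, zy)
    · subst hup
      exfalso
      have hy₁ : ((zx + 2, zy) : Pt) ∈ (((zx, zy - 1) : Pt) :: (zx, zy) :: (zx + 1, zy) :: (zx + 1, zy - 1) :: M) :=
        (mem_of_mem_cdarts h34).2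
      obtain ⟨y₂, hy⟩ := exists_cdarts_fst hy₁
      have hD' := hl₁.2.2 _ hy
      simp only at hD'
      by_cases hw : y₂ = (zx + 1, zy)
      · subst hw
        have := cdarts_pred_unique hnd₁ ((hmem _).2 hz) hy
        simp only [Prod.mk.injEq] at this; omega
      · have hy₂ : y₂ = (zx + 2 + 1, zy) := by
          obtain ⟨a, b⟩ := y₂
          simp only [IsDart] at hD'
          simp only [Prod.mk.injEq, not_and] at hw
          simp only [Prod.mk.injEq]; omega
        subst hy₂
        have := hmax (zx + 2, zy) ((hmem _).1 hy) rfl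
        simp only at this; omega
    · refine ⟨p₄, (mem_of_mem_cdarts h34).2, ?_⟩
      obtain ⟨a, b⟩ := p₄
      simp only [IsDart] at hD
      simp only [Prod.mk.injEq, not_and] at hup
      simp only; omega
  have hlo : lo2 (((zx, zy - 1) : Pt) :: (zx, zy) :: (zx + 1, zy) :: (zx + 1, zy - 1) :: M) ≤ zy - 2 := by
    obtain ⟨P, hP, hP2⟩ := hlow; exact (lo2_le hP).trans hP2
  have htop₁ : ∀ P ∈ (((zx, zy - 1) : Pt) :: (zx, zy) :: (zx + 1, zy) :: (zx + 1, zy - 1) :: M), P.2 ≤ zy :=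
    fun P hP => htop P ((hmemv P).1 hP)
  by_cases hq : (((zx, zy - 2) : Pt), ((zx + 1, zy - 2) : Pt)) ∈
      cdarts (((zx, zy - 1) : Pt) :: (zx, zy) :: (zx + 1, zy) :: (zx + 1, zy - 1) :: M)
  · -- the dart under `p₁ p₂` is on the trail: impossible
    exfalso
    have hq' : (((zx, zy - 2) : Pt), ((zx + 1, zy - 2) : Pt)) ∈ pdarts M := by
      rw [hc] at hq
      simp only [List.mem_append, List.mem_cons, List.not_mem_nil, or_false] at hq
      rcases hq with (h | h | h) | ((h | h) | h)
      · simp only [Prod.mk.injEq] at h; omega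
      · simp only [Prod.mk.injEq] at h; omega
      · simp only [Prod.mk.injEq] at h; omega
      · simp only [Prod.mk.injEq] at h; omega
      · exact h
      · simp only [Prod.mk.injEq] at h; omega
    obtain ⟨M₁, M₂, hMeq⟩ := exists_split_of_mem_pdarts hq'
    have hM₁ : M₁ ≠ [] := by
      rintro rfl
      subst hMeq
      simp only [List.nil_append, List.head_cons, Prod.mk.injEq] at hhead; omega
    have hM₂ : M₂ ≠ [] := by
      rintro rfl
      subst hMeq
      rw [List.getLast_append_of_ne_nil _ (by simp)] at hlast
      simp only [List.getLast_cons_cons, List.getLast_singleton, Prod.mk.injEq] at hlast; omega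
    exact bump_conflict hzodd hM₁ hM₂ hMeq hl₁ hnd₁ htop₁
  · -- reflect the bump down
    have ht₂ := bump_move_trail hzodd hM hl₁ hnd₁ hq
    have hΦ₂ := bump_move_Φ (M := M) hlo
    have hI₂ := hIH _ (by simp only [List.length_cons] at hlen ⊢; omega) (by rw [← hΦ]; omega) ht₂
    exact bump_move_inv hzodd hM hl₁ hnd₁ htop₁ hhead hlast hI₂

/-- **A horizontal dart in the top row.** The highest vertex has a horizontal dart at it (its
in-dart if it is even, its out-dart if it is odd). [folklore] -/
theorem exists_top_dart (hl : IsTrail l) :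
    ∃ y y' : Pt, (y, y') ∈ cdarts l ∧ y'.2 = y.2 ∧ (y'.1 = y.1 + 1 ∨ y'.1 = y.1 - 1) ∧ ∀ P ∈ l, P.2 ≤ y.2 := by
  have hne : l.toFinset.Nonempty := ⟨l.head hl.1, List.mem_toFinset.2 (List.head_mem hl.1)⟩
  obtain ⟨z₀, hz₀, hmax⟩ := l.toFinset.exists_max_image Prod.snd hne
  rw [List.mem_toFinset] at hz₀
  have hmax' : ∀ P ∈ l, P.2 ≤ z₀.2 := fun P hP => hmax P (List.mem_toFinset.2 hP)
  rcases Int.emod_two_eq_zero_or_one (z₀.1 + z₀.2) with hp | hp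
  · obtain ⟨u, hu⟩ := exists_cdarts_snd hz₀
    have hd := hl.2.2 _ hu
    simp only at hd
    obtain ⟨a, b⟩ := u; obtain ⟨c, d⟩ := z₀
    simp only [IsDart] at hd
    simp only at hp hmax' ⊢
    exact ⟨(a, b), (c, d), hu, by omega, by omega, fun P hP => by have := hmax' P hP; omega⟩
  · obtain ⟨w, hw⟩ := exists_cdarts_fst hz₀
    have hd := hl.2.2 _ hw
    simp only at hd
    obtain ⟨a, b⟩ := w; obtain ⟨c, d⟩ := z₀
    simp only [IsDart] at hd
    simp only at hp hmax' ⊢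
    exact ⟨(c, d), (a, b), hw, by omega, by omega, hmax'⟩

/-- **The vertex-simple case of the induction.** Pick, among the east darts of the top row, the one
starting furthest east and apply the bump step; if all top darts go west, pick the one starting
furthest west and apply the bump step to the reflected trail. [folklore] -/
theorem main_step (hl : IsTrail l) (hnd : l.Nodup) (h4 : 4 < l.length)
    (hIH : ∀ l' : List Pt, l'.length = l.length → Φ l' + 4 ≤ Φ l → IsTrail l' → INV l') : INV l := by
  classical
  obtain ⟨y, y', hyy, hy2, hor, htop⟩ := exists_top_dart hl
  by_cases hE : ∃ e : Pt, (e, (e.1 + 1, e.2)) ∈ cdarts l ∧ e.2 = y.2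
  · -- the eastmost east dart of the top row
    obtain ⟨e, he1, he2⟩ := hE
    set S : Finset (Pt × Pt) := ((cdarts l).filter (fun d => d.2 = (d.1.1 + 1, d.1.2) ∧ d.1.2 = y.2)).toFinset with hS
    have hmS : ∀ d : Pt × Pt, d ∈ S ↔ d ∈ cdarts l ∧ d.2 = (d.1.1 + 1, d.1.2) ∧ d.1.2 = y.2 := by
      intro d; rw [hS, List.mem_toFinset, List.mem_filter]; simp
    have hSne : S.Nonempty := ⟨(e, (e.1 + 1, e.2)), (hmS _).2 ⟨he1, rfl, he2⟩⟩
    obtain ⟨d, hd, hdmax⟩ := S.exists_max_image (fun d : Pt × Pt => d.1.1) hSne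
    obtain ⟨hd1, hd2, hd3⟩ := (hmS d).1 hd
    have hd1' : (d.1, (d.1.1 + 1, d.1.2)) ∈ cdarts l := by
      rw [← hd2]; exact hd1
    refine bump_step hl hnd h4 hIH hd1' (fun P hP => by rw [hd3]; exact htop P hP) ?_
    intro w hw hw2
    exact hdmax _ ((hmS _).2 ⟨hw, rfl, by rw [hw2, hd3]⟩)
  · -- all top darts go west: reflect
    have hyw : y' = (y.1 - 1, y.2) := by
      rcases hor with h | h
      · exfalso
        refine hE ⟨y, ?_, rfl⟩
        have e : y' = (y.1 + 1, y.2) := Prod.ext_iff.2 ⟨h, hy2⟩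
        rw [← e]
        exact hyy
      · exact Prod.ext_iff.2 ⟨h, hy2⟩
    subst hyw
    set S : Finset (Pt × Pt) := ((cdarts l).filter (fun d => d.2 = (d.1.1 - 1, d.1.2) ∧ d.1.2 = y.2)).toFinset with hS
    have hmS : ∀ d : Pt × Pt, d ∈ S ↔ d ∈ cdarts l ∧ d.2 = (d.1.1 - 1, d.1.2) ∧ d.1.2 = y.2 := by
      intro d; rw [hS, List.mem_toFinset, List.mem_filter]; simp
    have hSne : S.Nonempty := ⟨(y, (y.1 - 1, y.2)), (hmS _).2 ⟨hyy, rfl, rfl⟩⟩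
    obtain ⟨d, hd, hdmin⟩ := S.exists_min_image (fun d : Pt × Pt => d.1.1) hSne
    obtain ⟨hd1, hd2, hd3⟩ := (hmS d).1 hd
    apply inv_of_inv_map_refl hl
    have hlr := hl.map_refl
    have hndr : (l.map refl).Nodup := hnd.map refl_injective
    refine bump_step hlr hndr (by simpa using h4) ?_ (z := refl d.1) ?_ ?_ ?_
    · intro l' hl' hΦ' ht'
      exact hIH l' (by simpa using hl') (by rw [Φ_map_refl] at hΦ'; exact hΦ') ht'
    · rw [mem_cdarts_map_refl, refl_refl]
      have : refl (((refl d.1).1 + 1, (refl d.1).2) : Pt) = d.2 := by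
        rw [hd2]; simp only [refl, Prod.mk.injEq, and_true]; omega
      rw [this]; exact hd1
    · intro P hP
      rw [List.mem_map] at hP
      obtain ⟨Q, hQ, rfl⟩ := hP
      simp only [refl]; rw [hd3]; exact htop Q hQ
    · intro w hw hw2
      rw [mem_cdarts_map_refl] at hw
      simp only [refl] at hw hw2
      have hwS : ((-w.1, w.2), (-(w.1 + 1), w.2)) ∈ S := by
        refine (hmS _).2 ⟨hw, ?_, ?_⟩
        · simp only [Prod.mk.injEq, and_true]; omega
        · simp only; rw [hw2, hd3]
      have := hdmin _ hwS
      simp only [refl] at this ⊢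
      omega

/-- **One reduction step of the induction** (for trails of a fixed length, given the result for
shorter trails and for trails of the same length and potential smaller by `4`): a repeated vertex
splits the trail into two shorter ones (`inv_append`); a vertex-simple trail is a unit square or
has a top bump (`main_step`). [folklore] -/
theorem inv_step {n : ℕ} (ih : ∀ l : List Pt, l.length ≤ n → IsTrail l → INV l)
    (hl : IsTrail l) (hlen : l.length = n + 1)
    (hIH : ∀ l' : List Pt, l'.length = l.length → Φ l' + 4 ≤ Φ l → IsTrail l' → INV l') : INV l := by
  by_cases hnd : l.Nodup
  · rcases Nat.lt_or_ge 4 l.length with h4 | h4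
    · exact main_step hl hnd h4 hIH
    · exact inv_of_length_four hl (by have := hl.four_le_length; omega)
  · -- a repeated vertex: split
    have h4 := hl.four_le_length
    have hnd' : ¬ ∀ (i j : ℕ) (hi : i < l.length) (hj : j < l.length), i < j → l[i] ≠ l[j] := by
      rwa [← List.pairwise_iff_getElem]
    push Not at hnd'
    obtain ⟨i, j, hi, hj, hij, he⟩ := hnd'
    have e0 : (l.rotate i)[0]'(by simp; omega) = l[i] := by
      simp only [List.getElem_rotate, Nat.zero_add]
      congr 1; exact Nat.mod_eq_of_lt hi
    have e1 : (l.rotate i)[j - i]'(by simp; omega) = l[j] := by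
      simp only [List.getElem_rotate]
      congr 1; rw [Nat.sub_add_cancel hij.le]; exact Nat.mod_eq_of_lt hj
    have hA0 : (l.rotate i).take (j - i) ≠ [] := by
      intro h; have := congrArg List.length h
      rw [List.length_take, List.length_rotate, List.length_nil] at this; omega
    have hB0 : (l.rotate i).drop (j - i) ≠ [] := by
      intro h; have := congrArg List.length h
      rw [List.length_drop, List.length_rotate, List.length_nil] at this; omega
    have hhead : ((l.rotate i).take (j - i)).head hA0 = ((l.rotate i).drop (j - i)).head hB0 := by
      rw [List.head_drop, List.head_take, List.head_eq_getElem, e1]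
      exact e0.trans he
    have hl₁ : IsTrail (l.rotate i) := hl.rotate i
    rw [← inv_rotate_iff (l := l) (by omega) i]
    have hsplit : (l.rotate i).take (j - i) ++ (l.rotate i).drop (j - i) = l.rotate i := List.take_append_drop _ _
    rw [← hsplit] at hl₁ ⊢
    have hA := hl₁.left hA0 hB0 hhead
    have hB := hl₁.right hA0 hB0 hhead
    refine inv_append hl₁ hA0 hB0 hhead (ih _ ?_ hA) (ih _ ?_ hB)
    · rw [List.length_take_of_le (by rw [List.length_rotate]; omega)]; omega
    · rw [List.length_drop, List.length_rotate]; omega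

/-- **Combinatorial Umlaufsatz for the oriented medial graph**: every closed trail satisfies the
invariant — turning number `4` with winding numbers in `{0, 1}`, or turning number `-4` with
winding numbers in `{0, -1}`. Induction on the length, and for fixed length on the potential.
[cite: Hopf1935, Satz I] -/
theorem inv_of_isTrail (l : List Pt) (hl : IsTrail l) : INV l := by
  suffices H : ∀ (n : ℕ) (l : List Pt), l.length ≤ n → IsTrail l → INV l from H _ l le_rfl hl
  intro n
  induction n with
  | zero => intro l hl ht; have := ht.four_le_length; omega
  | succ n ih =>
    intro l hlen ht
    rcases Nat.lt_or_ge l.length (n + 1) with hlt | hge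
    · exact ih l (by omega) ht
    · have hleq : l.length = n + 1 := le_antisymm hlen hge
      have inner : ∀ (m : ℕ) (l : List Pt), l.length = n + 1 → Φ l ≤ m → IsTrail l → INV l := by
        intro m
        induction m with
        | zero =>
          intro l hl hΦ ht
          exact inv_step ih ht hl (fun l' _ h _ => by omega)
        | succ m ihm =>
          intro l hl hΦ ht
          exact inv_step ih ht hl (fun l' hl' h ht' => ihm l' (by omega) (by omega) ht')
      exact inner _ l hleq le_rfl ht

/-- **The turning number of a closed trail of the oriented medial graph is `±4`.**
[cite: Hopf1935, Satz I] -/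
theorem cturn_eq_four_or (l : List Pt) (hl : IsTrail l) : cturn l = 4 ∨ cturn l = -4 := by
  rcases inv_of_isTrail l hl with ⟨h, -⟩ | ⟨h, -⟩
  · exact Or.inl h
  · exact Or.inr h

end Main


end Literature.Probability.LatticeModels.MedialTrail

/-! ## Transfer: cycles of the turning rule are closed trails of the oriented medial graph -/

namespace Literature.Probability.LatticeModels

open MedialTrail

/-- Offset of the medial coordinates of the corner `(v, k)` from those of `(v, 0)`. [folklore] -/
def cposOff : Fin 4 → ℤ × ℤ := ![(0, 0), (0, 1), (-1, 1), (-1, 0)]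

/-- The step of the dart of a corner with face index `k`: north, west, south, east. [folklore] -/
def cdir : Fin 4 → ℤ × ℤ := ![(0, 1), (-1, 0), (0, -1), (1, 0)]

/-- **Medial coordinates of a coded corner** `(v, k)`: the midpoint `v + u_k/2` of its source
edge in the frame `(x, y) ↦ (x + y - ½, y - x + ½)` of the medial lattice, i.e.
`(v₀ + v₁, v₁ - v₀) + cposOff k`. [cite: Smirnov2010, §4, Fig. 5] -/
def cpos (p : Site 2 × Fin 4) : MedialTrail.Pt :=
  (p.1 0 + p.1 1 + (cposOff p.2).1, p.1 1 - p.1 0 + (cposOff p.2).2)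

/-- **One step of the turning rule is one dart of the oriented medial graph**: the medial
coordinates move by `cdir k`, whatever the configuration. [cite: Smirnov2010, §4] -/
theorem cpos_nextCorner (β : Percolation.BondConfig (Site 2)) (p : Site 2 × Fin 4) :
    cpos (nextCorner β p) = ((cpos p).1 + (cdir p.2).1, (cpos p).2 + (cdir p.2).2) := by
  classical
  obtain ⟨v, k⟩ := p
  by_cases h : cTgt (v, k) ∈ β
  · rw [nextCorner_of_mem h]
    simp only [cpos, Pi.add_apply, Prod.mk.injEq]
    fin_cases k <;> simp [cposOff, cdir, cornerUnit] <;> omega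
  · rw [nextCorner_of_not_mem h]
    simp only [cpos, Prod.mk.injEq]
    fin_cases k <;> simp [cposOff, cdir]

/-- The dart of a corner is a dart of the oriented medial graph. [cite: Smirnov2010, §4] -/
theorem isDart_cpos (β : Percolation.BondConfig (Site 2)) (p : Site 2 × Fin 4) :
    MedialTrail.IsDart (cpos p) (cpos (nextCorner β p)) := by
  rw [cpos_nextCorner]
  obtain ⟨v, k⟩ := p
  simp only [cpos, MedialTrail.IsDart]
  fin_cases k <;> simp [cposOff, cdir] <;> omega

/-- **The turn of the coded walk is the turn sign of the turning rule**: the darts of `p` and of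
`nextCorner β p` turn left (`+1`) across a closed edge and right (`-1`) along an open one.
[cite: Smirnov2010, §4] -/
theorem turn_cpos (β : Percolation.BondConfig (Site 2)) (p : Site 2 × Fin 4) :
    MedialTrail.turn (cpos p) (cpos (nextCorner β p)) (cpos (nextCorner β (nextCorner β p))) = turnSign β p := by
  classical
  rw [cpos_nextCorner β (nextCorner β p), cpos_nextCorner β p]
  obtain ⟨v, k⟩ := p
  by_cases h : cTgt (v, k) ∈ β
  · rw [turnSign_of_mem h, show (nextCorner β (v, k)).2 = k + 3 by rw [nextCorner_of_mem h]]
    simp only [MedialTrail.turn]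
    fin_cases k <;> simp [cdir]
  · rw [turnSign_of_not_mem h, show (nextCorner β (v, k)).2 = k + 1 by rw [nextCorner_of_not_mem h]]
    simp only [MedialTrail.turn]
    fin_cases k <;> simp [cdir]

/-- `cdir` is injective. [folklore] -/
theorem cdir_injective : Function.Injective cdir := by decide

/-- A corner is determined by its medial coordinates and its face index. [folklore] -/
theorem eq_of_cpos_eq {p q : Site 2 × Fin 4} (h : cpos p = cpos q) (hk : p.2 = q.2) : p = q := by
  obtain ⟨v, k⟩ := p; obtain ⟨w, j⟩ := q
  simp only at hk; subst hk
  simp only [cpos, Prod.mk.injEq] at h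
  have h0 : v 0 = w 0 := by omega
  have h1 : v 1 = w 1 := by omega
  refine Prod.ext (funext fun i => ?_) rfl
  fin_cases i
  · exact h0
  · exact h1

/-- The orbit of the turning rule is the iteration of `nextCorner`. [folklore] -/
theorem cornerOrbit_eq_iterate (β : Percolation.BondConfig (Site 2)) (c : Site 2 × Fin 4) (n : ℕ) :
    cornerOrbit β c n = (nextCorner β)^[n] c := by
  induction n with
  | zero => rfl
  | succ n ih => rw [Function.iterate_succ_apply', ← ih]; rfl

/-- **A cycle of minimal period visits distinct corners.** [folklore] -/
theorem cornerOrbit_injOn {β : Percolation.BondConfig (Site 2)} {q : Site 2 × Fin 4} {Q : ℕ}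
    (hmin : ∀ s, 0 < s → s < Q → cornerOrbit β q s ≠ q) {i j : ℕ} (hi : i < Q) (hj : j < Q)
    (h : cornerOrbit β q i = cornerOrbit β q j) : i = j := by
  wlog hij : i ≤ j generalizing i j
  · exact (this hj hi h.symm (by omega)).symm
  obtain ⟨d, rfl⟩ := Nat.exists_eq_add_of_le hij
  rw [cornerOrbit_eq_iterate, cornerOrbit_eq_iterate, Function.iterate_add_apply] at h
  have hd : (nextCorner β)^[d] q = q := (nextCorner_injective.iterate i h).symm
  rw [← cornerOrbit_eq_iterate] at hd
  by_contra hne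
  exact hmin d (by omega) (by omega) hd

namespace MedialTrail

/-- The darts of the cyclic list of the first `Q` points of a `Q`-periodic sequence. [folklore] -/
theorem cdarts_map_range (P : ℕ → Pt) {Q : ℕ} (hper : P Q = P 0) :
    cdarts ((List.range Q).map P) = (List.range Q).map (fun m => (P m, P (m + 1))) := by
  apply List.ext_getElem (by simp)
  intro i h1 h2
  simp only [length_cdarts, List.length_map, List.length_range] at h1 h2
  simp only [cdarts, List.getElem_zip, List.getElem_map, List.getElem_range, List.getElem_rotate,
    List.length_map, List.length_range, Prod.mk.injEq, true_and]
  rcases Nat.lt_or_ge (i + 1) Q with h | h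
  · rw [Nat.mod_eq_of_lt h]
  · rw [show i + 1 = Q by omega, Nat.mod_self, hper]

/-- The turn sum of the path through the first `n + 2` points of a sequence. [folklore] -/
theorem pturn_map_range (P : ℕ → Pt) : ∀ n : ℕ,
    pturn ((List.range (n + 2)).map P) = ∑ m ∈ Finset.range n, turn (P m) (P (m + 1)) (P (m + 2))
  | 0 => by simp [List.range_succ]
  | n + 1 => by
    rw [Finset.sum_range_succ, ← pturn_map_range P n, List.range_succ, List.map_append, List.map_singleton,
      show n + 2 = n + 1 + 1 from rfl, List.range_succ, List.range_succ, List.map_append, List.map_append,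
      List.map_singleton, List.map_singleton, List.append_assoc, List.append_assoc, List.singleton_append,
      List.singleton_append, pturn_append_cons_cons]
    simp

/-- **The turning number of the cyclic list of a `Q`-periodic sequence** (`Q ≥ 2`) is the sum of
its `Q` consecutive turns. [folklore] -/
theorem cturn_map_range (P : ℕ → Pt) {Q : ℕ} (hQ : 2 ≤ Q) (hper : P Q = P 0) (hper' : P (Q + 1) = P 1) :
    cturn ((List.range Q).map P) = ∑ m ∈ Finset.range Q, turn (P m) (P (m + 1)) (P (m + 2)) := by
  obtain ⟨n, rfl⟩ := Nat.exists_eq_add_of_le' hQ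
  rw [← pturn_map_range, cturn]
  congr 1
  have ht : ((List.range (n + 2)).map P).take 2 = [P 0, P 1] := by
    rw [← List.map_take, List.take_range, show min 2 (n + 2) = 2 by omega]; rfl
  rw [ht, show n + 2 + 2 = n + 2 + 1 + 1 from rfl, List.range_succ (n := n + 2 + 1), List.range_succ (n := n + 2),
    List.map_append, List.map_append, List.map_singleton, List.map_singleton, hper, hper', List.append_assoc]
  rfl

end MedialTrail

/-- **A cycle of the turning rule, in medial coordinates, is a closed trail of the oriented medial
graph.** For every bond configuration `β` and every cycle of `nextCorner β` of minimal period `Q`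
through `q`, the list of the medial coordinates `cpos (orb m)`, `m < Q`, is a `MedialTrail.IsTrail`
(the corners of a minimal period are distinct, `cornerOrbit_injOn`, and a corner is determined by
its coded dart, `eq_of_cpos_eq`, `cdir_injective`). This is the export through which the results
of the `MedialTrail` namespace (`inv_of_isTrail`: turning number and the sign pattern of the
winding number; `two_trails`) apply to the loops of the loop representation.
[cite: Smirnov2010, §4, Fig. 5] -/
theorem isTrail_cornerOrbit {β : Percolation.BondConfig (Site 2)} {q : Site 2 × Fin 4} {Q : ℕ} (hQ : 0 < Q)
    (hper : cornerOrbit β q Q = q) (hmin : ∀ s, 0 < s → s < Q → cornerOrbit β q s ≠ q) :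
    MedialTrail.IsTrail ((List.range Q).map fun m => cpos (cornerOrbit β q m)) := by
  have hsucc : ∀ m, cornerOrbit β q (m + 1) = nextCorner β (cornerOrbit β q m) := fun m => rfl
  have hperP : (fun m => cpos (cornerOrbit β q m)) Q = (fun m => cpos (cornerOrbit β q m)) 0 := by
    simp only [hper]; rfl
  refine ⟨by simp; omega, ?_, ?_⟩
  · rw [MedialTrail.cdarts_map_range _ hperP]
    refine List.Nodup.map_on ?_ (List.nodup_range)
    intro i hi j hj hij
    rw [List.mem_range] at hi hj
    simp only [Prod.mk.injEq, hsucc] at hij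
    obtain ⟨h1, h2⟩ := hij
    rw [cpos_nextCorner, cpos_nextCorner, h1, Prod.mk.injEq] at h2
    have hk : (cornerOrbit β q i).2 = (cornerOrbit β q j).2 :=
      cdir_injective (Prod.ext (by omega) (by omega))
    exact cornerOrbit_injOn hmin hi hj (eq_of_cpos_eq h1 hk)
  · rw [MedialTrail.cdarts_map_range _ hperP]
    intro d hd
    rw [List.mem_map] at hd
    obtain ⟨m, -, rfl⟩ := hd
    exact isDart_cpos β _

/-- **The turning number of the coded cycle is the sum of the turn signs** `∑_{m<Q} turnSign β (orb m)`.
[cite: Smirnov2010, §4] -/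
theorem cturn_cornerOrbit {β : Percolation.BondConfig (Site 2)} {q : Site 2 × Fin 4} {Q : ℕ} (hQ : 0 < Q)
    (hper : cornerOrbit β q Q = q) (hmin : ∀ s, 0 < s → s < Q → cornerOrbit β q s ≠ q) :
    MedialTrail.cturn ((List.range Q).map fun m => cpos (cornerOrbit β q m)) =
      ∑ m ∈ Finset.range Q, turnSign β (cornerOrbit β q m) := by
  have hsucc : ∀ m, cornerOrbit β q (m + 1) = nextCorner β (cornerOrbit β q m) := fun m => rfl
  have hperP : (fun m => cpos (cornerOrbit β q m)) Q = (fun m => cpos (cornerOrbit β q m)) 0 := by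
    simp only [hper]; rfl
  have hperP' : (fun m => cpos (cornerOrbit β q m)) (Q + 1) = (fun m => cpos (cornerOrbit β q m)) 1 := by
    simp only [hsucc, hper]; rfl
  have h4 := (isTrail_cornerOrbit hQ hper hmin).four_le_length
  simp only [List.length_map, List.length_range] at h4
  rw [MedialTrail.cturn_map_range _ (by omega) hperP hperP']
  refine Finset.sum_congr rfl fun m _ => ?_
  simp only [hsucc]
  exact turn_cpos β _

/-- **Turning number and sign of the winding number of a cycle of the turning rule** (the export
of `MedialTrail.inv_of_isTrail`): around a cycle of `nextCorner β` of minimal period `Q`, either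
`∑_{m<Q} turnSign β (orb m) = 4` and the winding number of the coded closed trail around every face
of the medial lattice is `0` or `1` (a counterclockwise loop: around the vertices of `ℤ²` inside
it), or `∑ turnSign = -4` and the winding number is everywhere `0` or `-1` (a clockwise loop). The
first components alone are the statement of the tree's `medialCycle_turning_holds`
(`MedialCycleHopf.lean`; second proof in `MedialCycleTurning.lean`), of which this is a third,
combinatorial, proof; the sign pattern is the discrete Jordan curve theorem for the loops of the
loop representation. [cite: Hopf1935, Satz I] -/
theorem inv_cornerOrbit {β : Percolation.BondConfig (Site 2)} {q : Site 2 × Fin 4} {Q : ℕ} (hQ : 0 < Q)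
    (hper : cornerOrbit β q Q = q) (hmin : ∀ s, 0 < s → s < Q → cornerOrbit β q s ≠ q) :
    (∑ m ∈ Finset.range Q, turnSign β (cornerOrbit β q m) = 4 ∧
        ∀ F, MedialTrail.wnd ((List.range Q).map fun m => cpos (cornerOrbit β q m)) F = 0 ∨
          MedialTrail.wnd ((List.range Q).map fun m => cpos (cornerOrbit β q m)) F = 1) ∨
      (∑ m ∈ Finset.range Q, turnSign β (cornerOrbit β q m) = -4 ∧
        ∀ F, MedialTrail.wnd ((List.range Q).map fun m => cpos (cornerOrbit β q m)) F = 0 ∨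
          MedialTrail.wnd ((List.range Q).map fun m => cpos (cornerOrbit β q m)) F = -1) := by
  rw [← cturn_cornerOrbit hQ hper hmin]
  exact MedialTrail.inv_of_isTrail _ (isTrail_cornerOrbit hQ hper hmin)

end Literature.Probability.LatticeModels
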